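import Literature.MathematicalPhysics.QuantumFieldTheory.Balaban1983to89.B13Bound226CentredRem
import Literature.MathematicalPhysics.QuantumFieldTheory.Balaban1983to89.B13ClippedFieldLetters

/-!
# `Balaban1983to89.B13Bound226CentredUnscaled` — T. Bałaban, *Renormalization group approach to lattice gauge field theories. II.
Cluster expansions*, Commun. Math. Phys. **116** (1988) 1–22 [Balaban1988RG2Cluster], pp. 12, 15–17 (with (1.20) p. 6), and
[Balaban1987RG1] (2.9)–(2.13) pp. 266–268: THE CENTRED LETTER ALONG THE WINDOW-DILATED FAMILY FOR THE UNSCALED-FIELD LAW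
`𝐕_s(Y,B) = s⁻²𝒲(Y,sB) + 𝒪(Y,sB)` FROM print-SHAPED **LOCAL** GROWTH LETTERS — the composition of the centred engine in its
exponential-moment edition (`B13Bound226CentredRem.h226_torus_windowDilated_centred_of_primitives_exp`) with the coordinatewise
clipping inhabitant of its last-line letters (`B13ClippedFieldLetters`): on the two-scale torus, for every member `b` of the ball
`|b − 1| < ρ_b`, `‖term(b²A, bG, F214 χ χᶜ 𝐕_s) − term(b²A, bG, F214 χ χᶜ 𝒪(·,0))‖ ≤ s²·weight L M c Z a t·e^{a₅|Z|}`, the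
last-line hypotheses being ONLY: measurability, the LOCAL letters (L0)–(L6) of `𝒲, 𝒲₃, 𝒪, D𝒪` on the sup-ball `‖A‖ ≤ ρ`
(print's analyticity domain «g_k|B| < ε₁»), the homogeneities of `𝒲₃, D𝒪`, the box-support law of `χ_{Y₀}` at the coupling
and the `Y`-locality of the potentials — no global-in-`B` letter, no Taylor letter, no parity hypothesis survives

statement-level skeleton of published theorems with citation tags; proofs where landed; nothing here is a claim about the
Yang–Mills mass gap

PDF held: `paper:balaban1988-cmp116-rg-ii-cluster` (journal page = PDF page + 0), pp. 6, 12, 15–17 (quoted in full in `B13Term214`,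
`B13FirstEstimate215`, `B13Replacement223`, `B13Bound226Primitive`, `B13Sect2Statements`); `paper:balaban1987-cmp109-rg-i`
pp. 266–268.

CITATION HEADER.  [II] p. 16 L17–27 after (2.20): *"the constant is small for κ₁ large, hence we can bound it by 1; using (1.28)
we obtain (2.20)"* — ON the domain (1.20) «g_k|B| < ε₁», under `χ_{k,Y₀}`; [I] p. 267 after (2.12): *"Next we make the scaling
transformation B = g_kB′ … Hence the only term with a negative power of g_k is the action evaluated at U_{k+1}. Terms of the
order 0 in g_k are (2.11)"*, p. 268 after (2.13): *"Let us remark that the expression under the exponential above vanishes at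
g_k = 0"*.  NOT PRINTED: the second-order (in the coupling) bound on the CENTRED term (print never centres); what is recorded
is that print's own chain gives it from print's own LOCAL regime, the `∀ B` letters of the tree's engines being met by the
clipped twin which `F214` cannot distinguish from the law (`B13ClippedFieldLetters.F214_clip_eq`).

PROVENANCE.  The composition recipe is the lens's (`run/shared/lean/pub/pub-ymgap/ym-lens-BalabanUVNodes-transfer/LENS-transfer.md`
§21.3 «junction recipe binder-by-binder», seat `ym-lens-BalabanUVNodes-transfer` g15, bus `run/shared/lean/pub/pub-ymgap/INBOX.md`
l.≈19578: *«keep 𝔇 on the UNclipped law; at the junction form 𝐕^π, prove lastLine^π = lastLine by `F214_clip_eq`, discharge …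
44B §3 (`h220U hw₀U h1eU h2eU hV₁o hV₀e hVm hV₀m hV₁m`) ON THE TWIN by the Sketch15 names, transport the conclusions back by the
equality»*); the typing is this seat's.  Cell `pub-ymgap`, seat `pub-ymgap-dag-n10-c` (g7), node N10 [B13]; consumers: node N22's
J7b (`Summits/…/BalabanUVNodesN22W1RelCentredMembersOfDatumCentred`, which displays `h1eU ∕ h2eU` at the datum) and the unseated
N09 ∕ Lemma-2 successor (instantiate at the W1 datum's `𝒲, 𝒪` once its LOCAL growth schema d13′ is typed).

WHAT IS HERE (no definition).
* §1 THE Y-WEIGHTED LETTERS OF THE CLIPPED TWIN (`hw₀U_clip_weighted`, `h220U_clip_weighted`, `h1eU_clip_weighted`,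
  `h2eU_clip_weighted`): `B13ClippedFieldLetters.hw₀U_clip ∕ h220U_clip ∕ h1eU_clip ∕ h2eU_clip` with the τ-region bound `R(Y)`
  and the local growth constants `c₀(Y), c₃(Y), c₃′(Y), c₄(Y), c₁(Y), c₁′(Y), c₂(Y)` DEPENDING ON THE DOMAIN `Y` and the aggregate
  constants the WEIGHTED SUMS `Σ_{Y∈𝐃} R(Y)c(Y)` — print's regime: `|τ(Y)|` ranges up to the large radius `(invTau …)⁻¹(Y)` while
  `𝐕(Y,·)` carries the compensating decay in `d_k(Y)` ((1.42)∕(2.20): the PRODUCT is what is bounded), so uniform constants would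
  pair the largest radius with the largest growth constant.
* §2 `h226_torus_windowDilated_centred_of_localGrowth`: `B13Bound226CentredRem.h226_torus_windowDilated_centred_of_primitives_exp`
  at `V := Vclip ρ s 𝒲 𝒪`, `V₀ := V₀ 𝒪`, `V₁ := V₁ s 𝒲₃ D𝒪` with ITS LAST-LINE BINDERS DISCHARGED by `B13ClippedFieldLetters` and §1
  (`measurable_Vclip ∕ V₀ ∕ V₁`, `V₀_even`, `V₁_odd`, `h220U_clip_weighted` with `a₂₀ = 2ρΣR(Y)c₃(Y)`, `w = ΣR(Y)(c₀(Y) + c₁(Y)ρ)`,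
  `hw₀U_clip_weighted` with `w₀ = ΣR(Y)c₀(Y)`, `h1eU∕h2eU_clip_weighted` with rates `a₁ = a₂ = δ` and the `s`-free weighted `K₁, K₂`),
  the three rate conditions collapsed to `2δ + 2ρΣR(Y)c₃(Y) ≤ a_c`, the centred constants' letter kept at the explicit constants,
  and the conclusion TRANSPORTED from the clipped twin to the law's member `Vlaw s 𝒲 𝒪` by `F214_clip_eq` (box-support law +
  `Y`-locality).
HONEST SCOPE.  Composition only; no estimate new in kind (the only Gaussian inequality is print's (2.15), inside the cited engine).
The LOCAL letters and their constants `c₀(Y) … c₄(Y), c₃′(Y), c₁′(Y)`, the clipping radius `ρ`, the τ-region bounds `R(Y)`, the box-support law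
and the locality are the PRODUCER's data about the datum ([I] (2.9)–(2.13), [II] (2.2)–(2.3)) — hypotheses here; `s > 0` is the
real base point.  Nothing of Bałaban's kernels or potentials is constructed; N10∕N22∕N09 NOT discharged.  No `sorry`, no
definition, no new named fact (D-0026).
-/

noncomputable section

namespace Literature.MathematicalPhysics.QuantumFieldTheory.Balaban1983to89.B13Bound226CentredUnscaled

open Matrix MeasureTheory Finset Complex Metric Set
open scoped Real
open B13Term214 (core214 F214 term214)
open B13Bound226CentredRem (h226_torus_windowDilated_centred_of_primitives_exp)
open B13CentredExpLetters (firstOrder_unscaled_gauss secondOrder_unscaled_gauss)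
open B13ClippedFieldLetters (clip Vclip Vlaw V₀ V₁ V₀_even V₁_odd measurable_Vclip measurable_V₀ measurable_V₁ F214_clip_eq
  norm_clip_le h220_clip_pointwise cubic_global_of_local linear_global_of_local quartic_global_of_local quadratic_global_of_local
  Vclip_sub_V₀ Vclip_sub_V₀_sub_V₁ abs_clip_le_abs)
open TreeLengthTorus (TPt TDom tsys)
open TreeLengthTorusTransfer (tclosure)
open B13Lemma3TorusData (TBond)
open B13Lemma3TorusTerms (weight Z0)
open B13Bound143 (invTau)
open B5TorusCover (UT)
open B9Thm37GlueTorus (tdist1)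

/-! ## §1. The Y-weighted letters of the clipped twin (τ-region bound `R(Y)` and growth constants depending on the domain) -/

section Weighted

variable {Λ : Type} [Fintype Λ]
variable {D : Type*}

omit [Fintype Λ] in
/-- **The centre's letter `hw₀U`, Y-weighted**: `Σ_Y |τ Y|·‖𝐕₀(Y,B)‖ ≤ Σ_Y R(Y)c₀(Y)` on a per-domain τ-region bounded by `R(Y)`,
from (L0) `‖𝒪(Y,0)‖ ≤ c₀(Y)` (the weighted edition of `B13ClippedFieldLetters.hw₀U_clip`).
[cite: Balaban1988RG2Cluster, (2.14) p.15, (2.20) p.16, (1.42) p.11; Balaban1987RG1, (2.13) p.268] -/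
theorem hw₀U_clip_weighted {𝒪 : D → (Λ → ℝ) → ℂ} (Dfam : Finset D) (Uτ : D → Set ℂ) {R c₀ : D → ℝ}
    (hR : ∀ Y ∈ Dfam, 0 ≤ R Y) (hUτ : ∀ Y ∈ Dfam, ∀ z ∈ Uτ Y, ‖z‖ ≤ R Y) (h0 : ∀ Y ∈ Dfam, ‖𝒪 Y 0‖ ≤ c₀ Y) :
    ∀ τ : D → ℂ, (∀ Y, τ Y ∈ Uτ Y) → ∀ B : Λ → ℝ,
      ∑ Y ∈ Dfam, ‖τ Y‖ * ‖V₀ 𝒪 Y B‖ ≤ ∑ Y ∈ Dfam, R Y * c₀ Y :=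
  fun τ hτ _ => Finset.sum_le_sum fun Y hY => mul_le_mul (hUτ Y hY (τ Y) (hτ Y)) (h0 Y hY) (norm_nonneg _) (hR Y hY)

/-- **The (2.20) letter `h220U` of the clipped member, Y-weighted, global in `B`, small rate**: for every `s > 0` and EVERY `B`,
`Σ_Y |τ Y|·‖𝐕^π_s(Y,B)‖ ≤ ½(2ρΣ_Y R(Y)c₃(Y))·B·B + Σ_Y R(Y)(c₀(Y) + c₁(Y)ρ)` from the LOCAL letters (L0), (L1), (L4) with
constants depending on `Y` (the weighted edition of `B13ClippedFieldLetters.h220U_clip`; print bounds the PRODUCTS `|τ(Y)||𝐕(Y,B)|`,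
the growth constants of `𝐕(Y,·)` carrying the decay that compensates the radius of `τ(Y)`).
[cite: Balaban1988RG2Cluster, (2.20) p.16, (1.42) p.11, (1.20) p.6, (2.14) p.15; Balaban1987RG1, (2.9)–(2.13) pp.266–268] -/
theorem h220U_clip_weighted {𝒲 𝒪 : D → (Λ → ℝ) → ℂ} (Dfam : Finset D) (Uτ : D → Set ℂ) {R c₀ c₁ c₃ : D → ℝ}
    {ρ s : ℝ} (hs : 0 < s) (hρ : 0 ≤ ρ) (hR : ∀ Y ∈ Dfam, 0 ≤ R Y) (hc₃ : ∀ Y ∈ Dfam, 0 ≤ c₃ Y)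
    (hc₁ : ∀ Y ∈ Dfam, 0 ≤ c₁ Y) (hUτ : ∀ Y ∈ Dfam, ∀ z ∈ Uτ Y, ‖z‖ ≤ R Y) (h0 : ∀ Y ∈ Dfam, ‖𝒪 Y 0‖ ≤ c₀ Y)
    (h1 : ∀ Y ∈ Dfam, ∀ A, ‖A‖ ≤ ρ → ‖𝒲 Y A‖ ≤ c₃ Y * ‖A‖ ^ 3)
    (h4 : ∀ Y ∈ Dfam, ∀ A, ‖A‖ ≤ ρ → ‖𝒪 Y A - 𝒪 Y 0‖ ≤ c₁ Y * ‖A‖) :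
    ∀ τ : D → ℂ, (∀ Y, τ Y ∈ Uτ Y) → ∀ B : Λ → ℝ,
      ∑ Y ∈ Dfam, ‖τ Y‖ * ‖Vclip ρ s 𝒲 𝒪 Y B‖
        ≤ (2 * ρ * (∑ Y ∈ Dfam, R Y * c₃ Y)) / 2 * (B ⬝ᵥ B) + ∑ Y ∈ Dfam, R Y * (c₀ Y + c₁ Y * ρ) := by
  intro τ hτ B
  have hE : ∀ Y ∈ Dfam, ‖τ Y‖ * ‖Vclip ρ s 𝒲 𝒪 Y B‖ ≤ R Y * (c₃ Y * ρ * (B ⬝ᵥ B) + (c₀ Y + c₁ Y * ρ)) := by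
    intro Y hY
    refine mul_le_mul (hUτ Y hY _ (hτ Y)) ?_ (norm_nonneg _) (hR Y hY)
    have hO : ‖𝒪 Y (clip ρ (s • B))‖ ≤ c₀ Y + c₁ Y * ρ := by
      have hd : ‖𝒪 Y (clip ρ (s • B)) - 𝒪 Y 0‖ ≤ c₁ Y * ρ :=
        (h4 Y hY _ (norm_clip_le hρ _)).trans (mul_le_mul_of_nonneg_left (norm_clip_le hρ _) (hc₁ Y hY))
      calc ‖𝒪 Y (clip ρ (s • B))‖ = ‖𝒪 Y 0 + (𝒪 Y (clip ρ (s • B)) - 𝒪 Y 0)‖ := by rw [add_sub_cancel]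
        _ ≤ ‖𝒪 Y 0‖ + ‖𝒪 Y (clip ρ (s • B)) - 𝒪 Y 0‖ := norm_add_le _ _
        _ ≤ c₀ Y + c₁ Y * ρ := add_le_add (h0 Y hY) hd
    calc ‖Vclip ρ s 𝒲 𝒪 Y B‖ ≤ ‖((s : ℂ) ^ 2)⁻¹ * 𝒲 Y (clip ρ (s • B))‖ + ‖𝒪 Y (clip ρ (s • B))‖ := norm_add_le _ _
      _ ≤ c₃ Y * ρ * (B ⬝ᵥ B) + (c₀ Y + c₁ Y * ρ) :=
          add_le_add (h220_clip_pointwise hs hρ (hc₃ Y hY) (h1 Y hY) B) hO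
  calc ∑ Y ∈ Dfam, ‖τ Y‖ * ‖Vclip ρ s 𝒲 𝒪 Y B‖
      ≤ ∑ Y ∈ Dfam, R Y * (c₃ Y * ρ * (B ⬝ᵥ B) + (c₀ Y + c₁ Y * ρ)) := Finset.sum_le_sum hE
    _ = ∑ Y ∈ Dfam, (R Y * c₃ Y * (ρ * (B ⬝ᵥ B)) + R Y * (c₀ Y + c₁ Y * ρ)) :=
        Finset.sum_congr rfl fun Y _ => by ring
    _ = (∑ Y ∈ Dfam, R Y * c₃ Y) * (ρ * (B ⬝ᵥ B)) + ∑ Y ∈ Dfam, R Y * (c₀ Y + c₁ Y * ρ) := by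
        rw [Finset.sum_add_distrib, Finset.sum_mul]
    _ = (2 * ρ * (∑ Y ∈ Dfam, R Y * c₃ Y)) / 2 * (B ⬝ᵥ B) + ∑ Y ∈ Dfam, R Y * (c₀ Y + c₁ Y * ρ) := by ring

/-- **The first exponential Taylor letter `h1eU` of the clipped twin, Y-weighted, `s`-free constant, any rate `δ > 0`**: for every
`s > 0` and EVERY `B`, `Σ_Y |τ Y|·‖𝐕^π_s(Y,B) − 𝐕₀(Y,B)‖ ≤ s·[Σ_Y R(Y)(c₃(Y)(3/(eδ))³ + c₁(Y)/(eδ))]e^{δ/2}·e^{½δ B·B}` from the LOCAL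
letters (L1), (L4) with constants depending on `Y` (the weighted edition of `B13ClippedFieldLetters.h1eU_clip`, via
`B13CentredExpLetters.firstOrder_unscaled_gauss` per domain).
[cite: Balaban1987RG1, (2.10)–(2.13) pp.267–268; Balaban1988RG2Cluster, (2.14) p.15, (2.20) p.16, (1.42) p.11] -/
theorem h1eU_clip_weighted {𝒲 𝒪 : D → (Λ → ℝ) → ℂ} (Dfam : Finset D) (Uτ : D → Set ℂ) {R c₃ c₁ : D → ℝ} {ρ s δ : ℝ}
    (hs : 0 < s) (hδ : 0 < δ) (hρ : 0 ≤ ρ) (hR : ∀ Y ∈ Dfam, 0 ≤ R Y) (hc₃ : ∀ Y ∈ Dfam, 0 ≤ c₃ Y)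
    (hc₁ : ∀ Y ∈ Dfam, 0 ≤ c₁ Y) (hUτ : ∀ Y ∈ Dfam, ∀ z ∈ Uτ Y, ‖z‖ ≤ R Y)
    (h1 : ∀ Y ∈ Dfam, ∀ A, ‖A‖ ≤ ρ → ‖𝒲 Y A‖ ≤ c₃ Y * ‖A‖ ^ 3)
    (h4 : ∀ Y ∈ Dfam, ∀ A, ‖A‖ ≤ ρ → ‖𝒪 Y A - 𝒪 Y 0‖ ≤ c₁ Y * ‖A‖) :
    ∀ τ : D → ℂ, (∀ Y, τ Y ∈ Uτ Y) → ∀ B : Λ → ℝ,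
      ∑ Y ∈ Dfam, ‖τ Y‖ * ‖Vclip ρ s 𝒲 𝒪 Y B - V₀ 𝒪 Y B‖
        ≤ s * (((∑ Y ∈ Dfam, R Y * (c₃ Y * (3 / (Real.exp 1 * δ)) ^ 3 + c₁ Y * (1 / (Real.exp 1 * δ))))
              * Real.exp (δ / 2)) * Real.exp (δ / 2 * (B ⬝ᵥ B))) := by
  intro τ hτ B
  have hE : ∀ Y ∈ Dfam, ‖τ Y‖ * ‖Vclip ρ s 𝒲 𝒪 Y B - V₀ 𝒪 Y B‖
      ≤ R Y * (s * (((c₃ Y * (3 / (Real.exp 1 * δ)) ^ 3 + c₁ Y * (1 / (Real.exp 1 * δ))) * Real.exp (δ / 2))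
          * Real.exp (δ / 2 * (B ⬝ᵥ B)))) := by
    intro Y hY
    have h𝒲π : ∀ A, ‖(fun A => 𝒲 Y (clip ρ A)) A‖ ≤ c₃ Y * ‖A‖ ^ 3 :=
      fun A => cubic_global_of_local hρ (hc₃ Y hY) (h1 Y hY) A
    have h𝒪π : ∀ A, ‖(fun A => 𝒪 Y (clip ρ A)) A - (fun A => 𝒪 Y (clip ρ A)) 0‖ ≤ c₁ Y * ‖A‖ :=
      fun A => linear_global_of_local hρ (hc₁ Y hY) (h4 Y hY) A
    have h := firstOrder_unscaled_gauss hs hδ (hc₃ Y hY) (hc₁ Y hY) h𝒲π h𝒪π B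
    rw [← Vclip_sub_V₀ hρ s Y B] at h
    exact mul_le_mul (hUτ Y hY _ (hτ Y)) h (norm_nonneg _) (hR Y hY)
  calc ∑ Y ∈ Dfam, ‖τ Y‖ * ‖Vclip ρ s 𝒲 𝒪 Y B - V₀ 𝒪 Y B‖
      ≤ ∑ Y ∈ Dfam, R Y * (s * (((c₃ Y * (3 / (Real.exp 1 * δ)) ^ 3 + c₁ Y * (1 / (Real.exp 1 * δ))) * Real.exp (δ / 2))
          * Real.exp (δ / 2 * (B ⬝ᵥ B)))) := Finset.sum_le_sum hE
    _ = ∑ Y ∈ Dfam, R Y * (c₃ Y * (3 / (Real.exp 1 * δ)) ^ 3 + c₁ Y * (1 / (Real.exp 1 * δ)))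
          * (s * (Real.exp (δ / 2) * Real.exp (δ / 2 * (B ⬝ᵥ B)))) := Finset.sum_congr rfl fun Y _ => by ring
    _ = (∑ Y ∈ Dfam, R Y * (c₃ Y * (3 / (Real.exp 1 * δ)) ^ 3 + c₁ Y * (1 / (Real.exp 1 * δ))))
          * (s * (Real.exp (δ / 2) * Real.exp (δ / 2 * (B ⬝ᵥ B)))) := by rw [Finset.sum_mul]
    _ = _ := by ring

/-- **The second exponential Taylor letter `h2eU` of the clipped twin, Y-weighted, `s`-free constant, any rate `δ > 0`**: for
every `s > 0` and EVERY `B`,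
`Σ_Y |τ Y|·‖𝐕^π_s − 𝐕₀ − 𝐕₁‖ ≤ s²·[Σ_Y R(Y)((c₄(Y)+(c₃(Y)+c₃′(Y))/ρ)(4/(eδ))⁴ + (c₂(Y)+(c₁(Y)+c₁′(Y))/ρ)(2/(eδ))²)]e^{δ/2}·e^{½δ B·B}`
from the LOCAL letters (L1), (L2), (L4), (L5), the global (L3), (L6) with constants depending on `Y`, and the homogeneities (the
weighted edition of `B13ClippedFieldLetters.h2eU_clip`, via `B13CentredExpLetters.secondOrder_unscaled_gauss` per domain).
[cite: Balaban1987RG1, (2.10)–(2.13) pp.267–268; Balaban1988RG2Cluster, (2.14) p.15, (2.20) p.16, (1.42) p.11] -/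
theorem h2eU_clip_weighted {𝒲 𝒲₃ 𝒪 D𝒪 : D → (Λ → ℝ) → ℂ} (Dfam : Finset D) (Uτ : D → Set ℂ)
    {R c₃ c₃' c₄ c₁ c₁' c₂ : D → ℝ} {ρ s δ : ℝ} (hs : 0 < s) (hδ : 0 < δ) (hρ : 0 < ρ) (hR : ∀ Y ∈ Dfam, 0 ≤ R Y)
    (hc₃ : ∀ Y ∈ Dfam, 0 ≤ c₃ Y) (hc₃' : ∀ Y ∈ Dfam, 0 ≤ c₃' Y) (hc₄ : ∀ Y ∈ Dfam, 0 ≤ c₄ Y)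
    (hc₁ : ∀ Y ∈ Dfam, 0 ≤ c₁ Y) (hc₁' : ∀ Y ∈ Dfam, 0 ≤ c₁' Y) (hc₂ : ∀ Y ∈ Dfam, 0 ≤ c₂ Y)
    (hUτ : ∀ Y ∈ Dfam, ∀ z ∈ Uτ Y, ‖z‖ ≤ R Y)
    (h1 : ∀ Y ∈ Dfam, ∀ A, ‖A‖ ≤ ρ → ‖𝒲 Y A‖ ≤ c₃ Y * ‖A‖ ^ 3)
    (h2 : ∀ Y ∈ Dfam, ∀ A, ‖A‖ ≤ ρ → ‖𝒲 Y A - 𝒲₃ Y A‖ ≤ c₄ Y * ‖A‖ ^ 4)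
    (h3 : ∀ Y ∈ Dfam, ∀ A, ‖𝒲₃ Y A‖ ≤ c₃' Y * ‖A‖ ^ 3)
    (h𝒲₃ : ∀ Y (r : ℝ) A, 𝒲₃ Y (r • A) = (r : ℂ) ^ 3 * 𝒲₃ Y A)
    (h4 : ∀ Y ∈ Dfam, ∀ A, ‖A‖ ≤ ρ → ‖𝒪 Y A - 𝒪 Y 0‖ ≤ c₁ Y * ‖A‖)
    (h5 : ∀ Y ∈ Dfam, ∀ A, ‖A‖ ≤ ρ → ‖𝒪 Y A - 𝒪 Y 0 - D𝒪 Y A‖ ≤ c₂ Y * ‖A‖ ^ 2)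
    (h6 : ∀ Y ∈ Dfam, ∀ A, ‖D𝒪 Y A‖ ≤ c₁' Y * ‖A‖)
    (hD𝒪 : ∀ Y (r : ℝ) A, D𝒪 Y (r • A) = (r : ℂ) * D𝒪 Y A) :
    ∀ τ : D → ℂ, (∀ Y, τ Y ∈ Uτ Y) → ∀ B : Λ → ℝ,
      ∑ Y ∈ Dfam, ‖τ Y‖ * ‖Vclip ρ s 𝒲 𝒪 Y B - V₀ 𝒪 Y B - V₁ s 𝒲₃ D𝒪 Y B‖
        ≤ s ^ 2 * (((∑ Y ∈ Dfam, R Y * ((c₄ Y + (c₃ Y + c₃' Y) / ρ) * (4 / (Real.exp 1 * δ)) ^ 4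
              + (c₂ Y + (c₁ Y + c₁' Y) / ρ) * (2 / (Real.exp 1 * δ)) ^ 2)) * Real.exp (δ / 2))
            * Real.exp (δ / 2 * (B ⬝ᵥ B))) := by
  intro τ hτ B
  have hE : ∀ Y ∈ Dfam, ‖τ Y‖ * ‖Vclip ρ s 𝒲 𝒪 Y B - V₀ 𝒪 Y B - V₁ s 𝒲₃ D𝒪 Y B‖
      ≤ R Y * (s ^ 2 * ((((c₄ Y + (c₃ Y + c₃' Y) / ρ) * (4 / (Real.exp 1 * δ)) ^ 4
          + (c₂ Y + (c₁ Y + c₁' Y) / ρ) * (2 / (Real.exp 1 * δ)) ^ 2) * Real.exp (δ / 2))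
            * Real.exp (δ / 2 * (B ⬝ᵥ B)))) := by
    intro Y hY
    have hc₄' : 0 ≤ c₄ Y + (c₃ Y + c₃' Y) / ρ :=
      add_nonneg (hc₄ Y hY) (div_nonneg (add_nonneg (hc₃ Y hY) (hc₃' Y hY)) hρ.le)
    have hc₂' : 0 ≤ c₂ Y + (c₁ Y + c₁' Y) / ρ :=
      add_nonneg (hc₂ Y hY) (div_nonneg (add_nonneg (hc₁ Y hY) (hc₁' Y hY)) hρ.le)
    have h𝒲π : ∀ A, ‖(fun A => 𝒲 Y (clip ρ A)) A - 𝒲₃ Y A‖ ≤ (c₄ Y + (c₃ Y + c₃' Y) / ρ) * ‖A‖ ^ 4 :=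
      fun A => quartic_global_of_local hρ (hc₃ Y hY) (hc₃' Y hY) (hc₄ Y hY) (h1 Y hY) (h2 Y hY) (h3 Y hY) A
    have h𝒪π : ∀ A, ‖(fun A => 𝒪 Y (clip ρ A)) A - (fun A => 𝒪 Y (clip ρ A)) 0 - D𝒪 Y A‖
        ≤ (c₂ Y + (c₁ Y + c₁' Y) / ρ) * ‖A‖ ^ 2 :=
      fun A => quadratic_global_of_local hρ (hc₁ Y hY) (hc₁' Y hY) (hc₂ Y hY) (h4 Y hY) (h5 Y hY) (h6 Y hY) A
    have h := secondOrder_unscaled_gauss hs hδ hc₄' hc₂' h𝒲π (h𝒲₃ Y) h𝒪π (hD𝒪 Y) B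
    rw [← Vclip_sub_V₀_sub_V₁ hρ.le s Y B] at h
    exact mul_le_mul (hUτ Y hY _ (hτ Y)) h (norm_nonneg _) (hR Y hY)
  calc ∑ Y ∈ Dfam, ‖τ Y‖ * ‖Vclip ρ s 𝒲 𝒪 Y B - V₀ 𝒪 Y B - V₁ s 𝒲₃ D𝒪 Y B‖
      ≤ ∑ Y ∈ Dfam, R Y * (s ^ 2 * ((((c₄ Y + (c₃ Y + c₃' Y) / ρ) * (4 / (Real.exp 1 * δ)) ^ 4
          + (c₂ Y + (c₁ Y + c₁' Y) / ρ) * (2 / (Real.exp 1 * δ)) ^ 2) * Real.exp (δ / 2))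
            * Real.exp (δ / 2 * (B ⬝ᵥ B)))) := Finset.sum_le_sum hE
    _ = ∑ Y ∈ Dfam, R Y * ((c₄ Y + (c₃ Y + c₃' Y) / ρ) * (4 / (Real.exp 1 * δ)) ^ 4
          + (c₂ Y + (c₁ Y + c₁' Y) / ρ) * (2 / (Real.exp 1 * δ)) ^ 2)
          * (s ^ 2 * (Real.exp (δ / 2) * Real.exp (δ / 2 * (B ⬝ᵥ B)))) := Finset.sum_congr rfl fun Y _ => by ring
    _ = (∑ Y ∈ Dfam, R Y * ((c₄ Y + (c₃ Y + c₃' Y) / ρ) * (4 / (Real.exp 1 * δ)) ^ 4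
          + (c₂ Y + (c₁ Y + c₁' Y) / ρ) * (2 / (Real.exp 1 * δ)) ^ 2))
          * (s ^ 2 * (Real.exp (δ / 2) * Real.exp (δ / 2 * (B ⬝ᵥ B)))) := by rw [Finset.sum_mul]
    _ = _ := by ring

end Weighted

/-! ## §2. The centred letter along the window-dilated family for the unscaled-field law, from LOCAL growth letters -/

section Torus

variable {d L N' : ℕ} [NeZero L] [NeZero N'] {M : ℕ}
variable {ν : ℕ} {Nf : Fin ν → ℕ} [∀ i, NeZero (Nf i)]
variable {Λ : Type} [Fintype Λ] [DecidableEq Λ] {C₀ : Type} [Fintype C₀] [DecidableEq C₀]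

open Classical in
/-- **THE CENTRED LETTER ALONG THE WINDOW-DILATED FAMILY FOR THE UNSCALED-FIELD LAW, FROM LOCAL GROWTH LETTERS** (node N22's
(S-vertex-T′) per term, for the b = 1 member `𝐕_s(Y,B) = s⁻²𝒲(Y,sB) + 𝒪(Y,sB)` of [I] p. 267 at a real base point `s > 0`, centre
`𝐕₀ = 𝒪(·,0)`).  Data and letters AT THE REAL COUPLING as in
`B13Bound226CentredRem.h226_torus_windowDilated_centred_of_primitives_exp` (kernels `A(σ)`, `Γ(σ)X = G(σ)·X`, boxes `χ, χᶜ ≥ 0`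
measurable and EVEN with (2.22), the reference `C ≻ 0`, `Γ₀`, the (L17a)∕(L16a) letters on the open σ-polydisc, `K_E`, `ρ_b < 1`
and the primed letters, the capstone's numeric conditions at `α = 2θ′ + γ₂ + a_c`, `hvol` with `w_c`), and for the last line ONLY:
the coupling-free functions `𝒲, 𝒲₃, 𝒪, D𝒪` (measurable in the field; `𝒲₃` cubic- and `D𝒪` linear-homogeneous under real
dilations), their LOCAL growth letters on the sup-ball `‖A‖ ≤ ρ` with constants DEPENDING ON THE DOMAIN — (L0) `‖𝒪(Y,0)‖ ≤ c₀(Y)`,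
(L1) `‖𝒲(Y,A)‖ ≤ c₃(Y)‖A‖³`, (L2) `‖𝒲 − 𝒲₃‖ ≤ c₄(Y)‖A‖⁴`, (L4) `‖𝒪(Y,A) − 𝒪(Y,0)‖ ≤ c₁(Y)‖A‖`,
(L5) `‖𝒪 − 𝒪(Y,0) − D𝒪‖ ≤ c₂(Y)‖A‖²` — and the global (L3) `‖𝒲₃‖ ≤ c₃′(Y)‖A‖³`, (L6) `‖D𝒪‖ ≤ c₁′(Y)‖A‖`, bounds `R(Y)` of the
per-domain τ-regions, the BOX-SUPPORT LAW `χ_{Y₀}(B) ≠ 0 → |sB(b)| ≤ ρ` on a coordinate set `S₀` and the `Y`-LOCALITY of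
`𝒲(Y,·)`, `𝒪(Y,·)` in `S₀` ([II] (2.2)–(2.3), [I] (2.9)); ONE rate condition `2δ + 2ρΣ_Y R(Y)c₃(Y) ≤ a_c` (any `δ > 0`) and the
centred constants' letter `e^{w₀}(K₂ + K₁²e^{w+w₀}) ≤ e^{w_c}` at the explicit weighted constants `w₀ = ΣR(Y)c₀(Y)`,
`w = ΣR(Y)(c₀(Y) + c₁(Y)ρ)`, `K₁ = [ΣR(Y)(c₃(Y)(3/(eδ))³ + c₁(Y)/(eδ))]e^{δ/2}`,
`K₂ = [ΣR(Y)((c₄+(c₃+c₃′)/ρ)(Y)(4/(eδ))⁴ + (c₂+(c₁+c₁′)/ρ)(Y)(2/(eδ))²)]e^{δ/2}`.  Conclusion: for every `b` of the ball,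
`‖term(b²A, bG, F214 χ χᶜ 𝐕_s) − term(b²A, bG, F214 χ χᶜ 𝐕₀)‖ ≤ s²·weight L M c Z a t·exp(a₅|Z|)`.  Proof: the cited engine on the
CLIPPED twin `Vclip ρ s 𝒲 𝒪` — every last-line binder discharged by `B13ClippedFieldLetters` and §1 — then
`F214(Vclip) = F214(Vlaw)` (`F214_clip_eq`).
[cite: Balaban1988RG2Cluster, (2.14)–(2.15) p.15, (2.16)–(2.22) p.16, (2.23)–(2.26) p.17, (2.2)–(2.3) p.12, (1.42) p.11, (1.20) p.6; Balaban1987RG1, (2.9)–(2.13) pp.266–268] -/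
theorem h226_torus_windowDilated_centred_of_localGrowth (c : B13.Consts) (hκ₁ : 1 ≤ c.κ₁) (hα₆ : c.α₆ ≠ 0)
    (Z : TDom d N') (t : Finset (TDom d (L * N')) × Finset (TBond d M (L * N')))
    (hpos : ∀ Y : TDom d (L * N'), 0 < invTau c ((tsys d (L * N')).dj Y))
    (hhalf : ∀ Y : TDom d (L * N'), invTau c ((tsys d (L * N')).dj Y) ≤ 1 / 2)
    {Uσ : Set ℂ} {Uτ : TDom d (L * N') → Set ℂ} (hUσ : IsOpen Uσ) (hUτ : ∀ Y, IsOpen (Uτ Y))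
    (hUexp : closedBall (0 : ℂ) (Real.exp c.κ₁) ⊆ Uσ)
    (hUtau : ∀ Y : TDom d (L * N'), closedBall (0 : ℂ) ((invTau c ((tsys d (L * N')).dj Y))⁻¹) ⊆ Uτ Y)
    {r : ℝ} (hr : 0 < r) (hr' : r ≤ Real.exp c.κ₁ - 1)
    (hsubτ : ∀ Y, ∀ s ∈ Set.uIcc (0 : ℝ) 1, closedBall (s : ℂ) r ⊆ Uτ Y)
    (lZ : List (TPt d N')) (hlZ : lZ.Nodup ∧ lZ.toFinset = Z.1 \ tclosure L N' (Z0 M t))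
    (lD : List (TDom d (L * N'))) (hlD : lD.Nodup ∧ lD.toFinset = t.1)
    -- the (2.14)-data AT THE REAL COUPLING (b = 1)
    (A : (TPt d N' → ℂ) → Matrix Λ Λ ℂ) (Γ : (TPt d N' → ℂ) → (Λ ⊕ C₀ → ℝ) → (Λ → ℂ))
    {χY₀ χcP : (Λ → ℝ) → ℝ} (hχ0 : ∀ B, 0 ≤ χY₀ B) (hχc0 : ∀ B, 0 ≤ χcP B)
    (hχe : ∀ B, χY₀ (-B) = χY₀ B) (hχce : ∀ B, χcP (-B) = χcP B) (Dfam : Finset (TDom d (L * N')))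
    -- the last line: the coupling-free functions of the unscaled-field law, at the coupling `s`, clipping radius `ρ`
    (𝒲 𝒲₃ 𝒪 D𝒪 : TDom d (L * N') → (Λ → ℝ) → ℂ) {ρ s : ℝ} (hs : 0 < s) (hρ : 0 < ρ)
    (h𝒲m : ∀ Y, Measurable (𝒲 Y)) (h𝒪m : ∀ Y, Measurable (𝒪 Y)) (h𝒲₃m : ∀ Y, Measurable (𝒲₃ Y))
    (hD𝒪m : ∀ Y, Measurable (D𝒪 Y))
    (h𝒲₃ : ∀ Y (r : ℝ) A, 𝒲₃ Y (r • A) = (r : ℂ) ^ 3 * 𝒲₃ Y A)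
    (hD𝒪 : ∀ Y (r : ℝ) A, D𝒪 Y (r • A) = (r : ℂ) * D𝒪 Y A)
    {C : Matrix Λ Λ ℝ} (hC : C.PosDef) (Γ₀ : Matrix Λ (Λ ⊕ C₀) ℝ)
    (hAhol : ∀ i j, DifferentiableOn ℂ (fun σ => A σ i j) {σ | ∀ j, σ j ∈ Uσ})
    (hχm : Measurable χY₀) (hχcm : Measurable χcP)
    (hAs : ∀ σ : TPt d N' → ℂ, (∀ j, σ j ∈ Uσ) → (A σ).IsSymm)
    (G : (TPt d N' → ℂ) → Matrix Λ (Λ ⊕ C₀) ℂ)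
    (hGhol : ∀ i j, DifferentiableOn ℂ (fun σ => G σ i j) {σ | ∀ j, σ j ∈ Uσ})
    (hlin : ∀ σ : TPt d N' → ℂ, (∀ j, σ j ∈ Uσ) → ∀ X : Λ ⊕ C₀ → ℝ, Γ σ X = G σ *ᵥ fun j => (X j : ℂ))
    -- (2.22)
    {γ₂ rP ac wc δ : ℝ} (qP : (Λ → ℝ) → ℝ)
    (h222 : ∀ B, χY₀ B * χcP B ≤ Real.exp (-(γ₂ / 2 * rP ^ 2 * (t.2.card : ℕ)) + γ₂ / 2 * qP B)) (hγ₂ : 0 ≤ γ₂)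
    (hqP : ∀ B, qP B ≤ B ⬝ᵥ B)
    -- the per-domain τ-regions are bounded by R(Y); the LOCAL growth letters (L0)–(L6) on the sup-ball of radius ρ with
    -- constants depending on the domain; any rate δ > 0
    (hδ : 0 < δ) {R c₀ c₃ c₃' c₄ c₁ c₁' c₂ : TDom d (L * N') → ℝ} (hR : ∀ Y ∈ Dfam, 0 ≤ R Y)
    (hc₃ : ∀ Y ∈ Dfam, 0 ≤ c₃ Y) (hc₃' : ∀ Y ∈ Dfam, 0 ≤ c₃' Y) (hc₄ : ∀ Y ∈ Dfam, 0 ≤ c₄ Y)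
    (hc₁ : ∀ Y ∈ Dfam, 0 ≤ c₁ Y) (hc₁' : ∀ Y ∈ Dfam, 0 ≤ c₁' Y) (hc₂ : ∀ Y ∈ Dfam, 0 ≤ c₂ Y)
    (hUτR : ∀ Y ∈ Dfam, ∀ z ∈ Uτ Y, ‖z‖ ≤ R Y)
    (h0 : ∀ Y ∈ Dfam, ‖𝒪 Y 0‖ ≤ c₀ Y)
    (h1 : ∀ Y ∈ Dfam, ∀ A, ‖A‖ ≤ ρ → ‖𝒲 Y A‖ ≤ c₃ Y * ‖A‖ ^ 3)
    (h2 : ∀ Y ∈ Dfam, ∀ A, ‖A‖ ≤ ρ → ‖𝒲 Y A - 𝒲₃ Y A‖ ≤ c₄ Y * ‖A‖ ^ 4)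
    (h3 : ∀ Y ∈ Dfam, ∀ A, ‖𝒲₃ Y A‖ ≤ c₃' Y * ‖A‖ ^ 3)
    (h4 : ∀ Y ∈ Dfam, ∀ A, ‖A‖ ≤ ρ → ‖𝒪 Y A - 𝒪 Y 0‖ ≤ c₁ Y * ‖A‖)
    (h5 : ∀ Y ∈ Dfam, ∀ A, ‖A‖ ≤ ρ → ‖𝒪 Y A - 𝒪 Y 0 - D𝒪 Y A‖ ≤ c₂ Y * ‖A‖ ^ 2)
    (h6 : ∀ Y ∈ Dfam, ∀ A, ‖D𝒪 Y A‖ ≤ c₁' Y * ‖A‖)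
    -- the BOX-SUPPORT LAW at the coupling and the Y-LOCALITY of the potentials (F214 does not see the clipping)
    (S₀ : Set Λ) (hbox : ∀ B, χY₀ B ≠ 0 → ∀ b ∈ S₀, |(s • B) b| ≤ ρ)
    (hloc𝒲 : ∀ Y ∈ Dfam, ∀ A A' : Λ → ℝ, (∀ b ∈ S₀, A b = A' b) → 𝒲 Y A = 𝒲 Y A')
    (hloc𝒪 : ∀ Y ∈ Dfam, ∀ A A' : Λ → ℝ, (∀ b ∈ S₀, A b = A' b) → 𝒪 Y A = 𝒪 Y A')
    -- ONE rate condition and the centred constants' letter at the explicit weighted constants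
    (hac : 2 * δ + 2 * ρ * (∑ Y ∈ Dfam, R Y * c₃ Y) ≤ ac)
    (hwc : Real.exp (∑ Y ∈ Dfam, R Y * c₀ Y)
        * ((∑ Y ∈ Dfam, R Y * ((c₄ Y + (c₃ Y + c₃' Y) / ρ) * (4 / (Real.exp 1 * δ)) ^ 4
              + (c₂ Y + (c₁ Y + c₁' Y) / ρ) * (2 / (Real.exp 1 * δ)) ^ 2)) * Real.exp (δ / 2)
           + ((∑ Y ∈ Dfam, R Y * (c₃ Y * (3 / (Real.exp 1 * δ)) ^ 3 + c₁ Y * (1 / (Real.exp 1 * δ))))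
                * Real.exp (δ / 2)) ^ 2
              * Real.exp ((∑ Y ∈ Dfam, R Y * (c₀ Y + c₁ Y * ρ)) + ∑ Y ∈ Dfam, R Y * c₀ Y))
        ≤ Real.exp wc)
    -- bonds located on the torus `UT Nf`
    (locΛ : Λ → UT Nf) (locN : Λ ⊕ C₀ → UT Nf) {m : ℕ}
    (hfibΛ : ∀ x : UT Nf, (Finset.univ.filter fun i => locΛ i = x).card ≤ m)
    (hfibN : ∀ x : UT Nf, (Finset.univ.filter fun j => locN j = x).card ≤ m)
    -- rates and the letters AT b = 1 (+ K_E)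
    {kap kap' kap'' θ θE θΓ θC KG KΓ KCs K₀ KE : ℝ} (hkap'' : 0 < kap'') (hk1 : kap'' < kap') (hk2 : kap' < kap)
    (hθE : 0 ≤ θE) (hθΓ : 0 ≤ θΓ) (hθC : 0 ≤ θC) (hKG : 0 ≤ KG) (hKΓ : 0 ≤ KΓ) (hKCs : 0 ≤ KCs) (hK₀ : 0 ≤ K₀)
    (hKE : 0 ≤ KE)
    (hG : ∀ σ : TPt d N' → ℂ, (∀ j, σ j ∈ Uσ) →
      ∀ b j, ‖G σ b j‖ ≤ KG * Real.exp (-(kap * tdist1 Nf (locΛ b) (locN j))))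
    (hΓ₀ : ∀ b j, ‖Γ₀ b j‖ ≤ KΓ * Real.exp (-(kap * tdist1 Nf (locΛ b) (locN j))))
    (hCs : ∀ σ : TPt d N' → ℂ, (∀ j, σ j ∈ Uσ) →
      ∀ b b', ‖(A σ)⁻¹ b b'‖ ≤ KCs * Real.exp (-(kap * tdist1 Nf (locΛ b) (locΛ b'))))
    (hC216 : ∀ b b', ‖C b b'‖ ≤ K₀ * Real.exp (-(kap * tdist1 Nf (locΛ b) (locΛ b'))))
    (hCE : ∀ b b', ‖(C⁻¹.map (algebraMap ℝ ℂ)) b b'‖ ≤ KE * Real.exp (-(kap * tdist1 Nf (locΛ b) (locΛ b'))))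
    (hdΓ : ∀ σ : TPt d N' → ℂ, (∀ j, σ j ∈ Uσ) →
      ∀ b j, ‖(G σ - Γ₀.map (algebraMap ℝ ℂ)) b j‖ ≤ θΓ * Real.exp (-(kap * tdist1 Nf (locΛ b) (locN j))))
    (hdC : ∀ σ : TPt d N' → ℂ, (∀ j, σ j ∈ Uσ) →
      ∀ b b', ‖((A σ)⁻¹ - C.map (algebraMap ℝ ℂ)) b b'‖
        ≤ θC * Real.exp (-(kap * tdist1 Nf (locΛ b) (locΛ b'))))
    (hdE : ∀ σ : TPt d N' → ℂ, (∀ j, σ j ∈ Uσ) →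
      ∀ b b', ‖(A σ - C⁻¹.map (algebraMap ℝ ℂ)) b b'‖ ≤ θE * Real.exp (-(kap * tdist1 Nf (locΛ b) (locΛ b'))))
    {ρb KG' KCs' θΓ' θC' θE' : ℝ} (hρb1 : ρb < 1)
    (hKG' : (1 + ρb) * KG ≤ KG') (hKCs' : ((1 - ρb) ^ 2)⁻¹ * KCs ≤ KCs')
    (hθΓ' : θΓ + ρb * KG ≤ θΓ') (hθC' : θC + ρb * (2 + ρb) * ((1 - ρb) ^ 2)⁻¹ * KCs ≤ θC')
    (hθE' : θE + ρb * (2 + ρb) * (θE + KE) ≤ θE')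
    -- the capstone's numeric conditions in the primed letters, at the master rate γ₂ + a_c, with w_c
    (hθEle : θE' ≤ θ) (hθΓle : θΓ' ≤ θ)
    (hθR1le : (m * (1 + 2 / (kap - kap')) ^ ν) * (m * (1 + 2 / (kap' - kap'')) ^ ν)
      * (θΓ' * KCs' * KG' + KΓ * θC' * KG' + KΓ * K₀ * θΓ') ≤ θ)
    (hsmallKθ : K₀ * (m * (1 + 2 / kap) ^ ν) * (θ * (m * (1 + 2 / kap'') ^ ν)) < 1)
    {cE g : ℝ} (hc0 : 0 ≤ cE) (hc : ∀ k, hC.1.eigenvalues k ≤ cE)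
    (hαc : (2 * (θ * (m * (1 + 2 / kap'') ^ ν)) + (γ₂ + ac)) * cE ≤ 1 / 2) (hg : 0 ≤ g)
    (hΓq : ∀ X : Λ ⊕ C₀ → ℝ, (Γ₀ *ᵥ X) ⬝ᵥ (C *ᵥ (Γ₀ *ᵥ X)) ≤ g * (X ⬝ᵥ X))
    (hsmall : (2 * (θ * (m * (1 + 2 / kap'') ^ ν)) + (γ₂ + ac)) * (1 + 2 * cE * g) ≤ 1 / 2)
    {a a₅ : ℝ} (hPa : a ≤ γ₂ * rP ^ 2)
    (hvol : 2 * (K₀ * (m * (1 + 2 / kap) ^ ν) * (θ * (m * (1 + 2 / kap'') ^ ν))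
              * (1 + (1 - K₀ * (m * (1 + 2 / kap) ^ ν) * (θ * (m * (1 + 2 / kap'') ^ ν)))⁻¹) / 2)
          * (Fintype.card Λ : ℝ)
        + wc + (2 * (θ * (m * (1 + 2 / kap'') ^ ν)) + (γ₂ + ac)) * cE * (Fintype.card Λ : ℝ)
        + (2 * (θ * (m * (1 + 2 / kap'') ^ ν)) + (γ₂ + ac)) * (1 + 2 * cE * g) * (Fintype.card (Λ ⊕ C₀) : ℝ)
        ≤ a₅ * ((Z.1).card : ℝ))
    {b : ℂ} (hb : b ∈ ball (1 : ℂ) ρb) :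
    ‖term214 r lZ lD (core214 (fun σ => b ^ 2 • A σ) (fun σ X => b • Γ σ X)
          (F214 t.2.card χY₀ χcP Dfam (Vlaw s 𝒲 𝒪))) 0 0
        - term214 r lZ lD (core214 (fun σ => b ^ 2 • A σ) (fun σ X => b • Γ σ X)
          (F214 t.2.card χY₀ χcP Dfam (V₀ 𝒪))) 0 0‖ ≤
      s ^ 2 * (weight L M c Z a t * Real.exp (a₅ * ((Z.1).card : ℝ))) := by
  -- transport: the (2.14) last line does not see the clipping
  have hF : F214 t.2.card χY₀ χcP Dfam (Vlaw s 𝒲 𝒪) = F214 t.2.card χY₀ χcP Dfam (Vclip ρ s 𝒲 𝒪) := by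
    funext τ B
    exact (F214_clip_eq t.2.card χY₀ χcP Dfam S₀ hbox hloc𝒲 hloc𝒪 τ B).symm
  rw [hF]
  -- the weighted rates: a₂₀ = 2ρ Σ R c₃, a₁ = a₂ = δ
  have hS₃ : 0 ≤ ∑ Y ∈ Dfam, R Y * c₃ Y := Finset.sum_nonneg fun Y hY => mul_nonneg (hR Y hY) (hc₃ Y hY)
  have ha₂₀ : 0 ≤ 2 * ρ * (∑ Y ∈ Dfam, R Y * c₃ Y) := by positivity
  have hac₀ : 2 * ρ * (∑ Y ∈ Dfam, R Y * c₃ Y) ≤ ac := by linarith only [hac, hδ.le]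
  have hac₂ : δ ≤ ac := by linarith only [hac, hδ.le, ha₂₀]
  have hK₁ : 0 ≤ (∑ Y ∈ Dfam, R Y * (c₃ Y * (3 / (Real.exp 1 * δ)) ^ 3 + c₁ Y * (1 / (Real.exp 1 * δ))))
      * Real.exp (δ / 2) :=
    mul_nonneg (Finset.sum_nonneg fun Y hY => mul_nonneg (hR Y hY)
      (add_nonneg (mul_nonneg (hc₃ Y hY) (by positivity)) (mul_nonneg (hc₁ Y hY) (by positivity)))) (Real.exp_pos _).le
  have hK₂ : 0 ≤ (∑ Y ∈ Dfam, R Y * ((c₄ Y + (c₃ Y + c₃' Y) / ρ) * (4 / (Real.exp 1 * δ)) ^ 4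
      + (c₂ Y + (c₁ Y + c₁' Y) / ρ) * (2 / (Real.exp 1 * δ)) ^ 2)) * Real.exp (δ / 2) :=
    mul_nonneg (Finset.sum_nonneg fun Y hY => mul_nonneg (hR Y hY)
      (add_nonneg
        (mul_nonneg (add_nonneg (hc₄ Y hY) (div_nonneg (add_nonneg (hc₃ Y hY) (hc₃' Y hY)) hρ.le)) (by positivity))
        (mul_nonneg (add_nonneg (hc₂ Y hY) (div_nonneg (add_nonneg (hc₁ Y hY) (hc₁' Y hY)) hρ.le)) (by positivity))))
      (Real.exp_pos _).le
  -- the engine on the clipped twin, every last-line binder discharged by `B13ClippedFieldLetters` and §1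
  exact h226_torus_windowDilated_centred_of_primitives_exp c hκ₁ hα₆ Z t hpos hhalf hUσ hUτ hUexp hUtau hr hr' hsubτ lZ hlZ
    lD hlD A Γ hχ0 hχc0 hχe hχce Dfam hC Γ₀ hAhol hχm hχcm (measurable_Vclip ρ s h𝒲m h𝒪m) (measurable_V₀ 𝒪)
    (measurable_V₁ s h𝒲₃m hD𝒪m) (V₀_even 𝒪) (V₁_odd s h𝒲₃ hD𝒪) hAs G hGhol hlin qP h222 hγ₂ hqP ha₂₀
    (h220U_clip_weighted Dfam Uτ hs hρ.le hR hc₃ hc₁ hUτR h0 h1 h4) (hw₀U_clip_weighted Dfam Uτ hR hUτR h0)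
    hs.le hK₁ hK₂ hδ.le
    (h1eU_clip_weighted Dfam Uτ hs hδ hρ.le hR hc₃ hc₁ hUτR h1 h4)
    (h2eU_clip_weighted Dfam Uτ hs hδ hρ hR hc₃ hc₃' hc₄ hc₁ hc₁' hc₂ hUτR h1 h2 h3 h𝒲₃ h4 h5 h6 hD𝒪)
    hac₀ hac₂ hac hwc
    locΛ locN hfibΛ hfibN hkap'' hk1 hk2 hθE hθΓ hθC hKG hKΓ hKCs hK₀ hKE hG hΓ₀ hCs hC216 hCE hdΓ hdC hdE hρb1 hKG'
    hKCs' hθΓ' hθC' hθE' hθEle hθΓle hθR1le hsmallKθ hc0 hc hαc hg hΓq hsmall hPa hvol hb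

end Torus

/-! ## §3. The PER-BOND rate (v1.1; port of lens Sketch17 with provenance): per-bond Fubini, the Y-localised cubic letter,
`h220U` for the clipped twin with a volume-free rate, and the shell mechanism for the multiplicity -/

section PerBond

variable {Λ : Type} [Fintype Λ]
variable {D : Type*}

/-- **WHY v1.1 (the arithmetic obstruction; lens Sketch17 `ySum_rate_caps_card`, erratum E8).**  If a sub-family `Q ⊆ 𝐃` (the
M-cubes of the region) contributes at least `r₁ > 0` per domain to the Y-summed rate aggregate of §2, the other contributions are
nonnegative, and §2's rate condition `2δ + 2ρ·Σ_{Y∈𝐃} R(Y)c₃(Y) ≤ a_c` holds, then `#Q ≤ a_c ∕ (2ρ r₁)`: §2's currency is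
instantiable only for clusters of bounded size, whereas Lemma 3 needs every `Z` uniformly — hence the per-bond rate below.
[cite: Balaban1988RG2Cluster, (2.19)–(2.20) p.16] (elementary arithmetic about the letter shapes) -/
theorem ySum_rate_caps_card (Dfam Q : Finset D) {R c₃ : D → ℝ} {ρ δ ac r₁ : ℝ} (hρ : 0 < ρ) (hr₁ : 0 < r₁)
    (hδ : 0 ≤ δ) (hQ : Q ⊆ Dfam) (hnn : ∀ Y ∈ Dfam, 0 ≤ R Y * c₃ Y) (hlow : ∀ Y ∈ Q, r₁ ≤ R Y * c₃ Y)
    (hac : 2 * δ + 2 * ρ * (∑ Y ∈ Dfam, R Y * c₃ Y) ≤ ac) :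
    (Q.card : ℝ) ≤ ac / (2 * ρ * r₁) := by
  have hQsum : (Q.card : ℝ) * r₁ ≤ ∑ Y ∈ Q, R Y * c₃ Y := by
    have h := Finset.card_nsmul_le_sum Q (fun Y => R Y * c₃ Y) r₁ hlow
    simpa [nsmul_eq_mul] using h
  have hmono : ∑ Y ∈ Q, R Y * c₃ Y ≤ ∑ Y ∈ Dfam, R Y * c₃ Y :=
    Finset.sum_le_sum_of_subset_of_nonneg hQ fun Y hY _ => hnn Y hY
  rw [le_div_iff₀ (by positivity)]
  calc (Q.card : ℝ) * (2 * ρ * r₁) = 2 * ρ * ((Q.card : ℝ) * r₁) := by ring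
    _ ≤ 2 * ρ * ∑ Y ∈ Dfam, R Y * c₃ Y := mul_le_mul_of_nonneg_left (hQsum.trans hmono) (by positivity)
    _ ≤ ac := by linarith

/-- Finite Fubini over the incidence relation `b ∈ S Y` (lens Sketch17 `sum_mul_sum_eq_sum_mul_sum_filter`):
`Σ_{Y∈𝐃} w(Y)·Σ_{b∈S Y} f(b) = Σ_b f(b)·Σ_{Y∈𝐃, b∈S Y} w(Y)`. [cite: Balaban1988RG2Cluster, (2.19)–(2.20) p.16] (elementary API for the per-bond resummation) -/
theorem sum_mul_sum_eq_sum_mul_sum_filter [DecidableEq Λ] (Dfam : Finset D) (S : D → Finset Λ)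
    (w : D → ℝ) (f : Λ → ℝ) :
    ∑ Y ∈ Dfam, w Y * ∑ b ∈ S Y, f b = ∑ b, f b * ∑ Y ∈ Dfam with b ∈ S Y, w Y := by
  have h1 : ∀ Y, w Y * ∑ b ∈ S Y, f b = ∑ b, if b ∈ S Y then w Y * f b else 0 := by
    intro Y
    rw [Finset.mul_sum, ← Finset.sum_filter]
    congr 1
    ext b
    simp
  have h2 : ∀ b, f b * ∑ Y ∈ Dfam with b ∈ S Y, w Y = ∑ Y ∈ Dfam, if b ∈ S Y then w Y * f b else 0 := by
    intro b
    rw [Finset.sum_filter, Finset.mul_sum]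
    refine Finset.sum_congr rfl fun Y _ => ?_
    split_ifs <;> ring
  simp_rw [h1, h2]
  exact Finset.sum_comm

/-- **The per-bond resummation** (lens Sketch17 `sum_weight_localSq_le`; [II] p.16, (2.19) → (2.20): «resummed over all Y∈𝐃_k
containing … the point b»): a per-bond multiplicity bound `∀ b, Σ_{Y∋b} w(Y) ≤ m` turns the Y-sum of LOCAL quadratic forms into
`m` times the global one: `Σ_Y w(Y)·Σ_{b∈S Y} B_b² ≤ m·(B·B)` (no sign condition on `w`). [cite: Balaban1988RG2Cluster, (2.19)–(2.20) p.16] -/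
theorem sum_weight_localSq_le [DecidableEq Λ] (Dfam : Finset D) (S : D → Finset Λ) {w : D → ℝ} {m : ℝ}
    (hm : ∀ b, ∑ Y ∈ Dfam with b ∈ S Y, w Y ≤ m) (B : Λ → ℝ) :
    ∑ Y ∈ Dfam, w Y * ∑ b ∈ S Y, B b ^ 2 ≤ m * (B ⬝ᵥ B) := by
  rw [sum_mul_sum_eq_sum_mul_sum_filter, dotProduct, Finset.mul_sum]
  refine Finset.sum_le_sum fun b _ => ?_
  calc B b ^ 2 * ∑ Y ∈ Dfam with b ∈ S Y, w Y ≤ B b ^ 2 * m := mul_le_mul_of_nonneg_left (hm b) (sq_nonneg _)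
    _ = m * (B b * B b) := by ring

/-- A coordinate is bounded by the sup norm (lens Sketch17 `abs_apply_le_norm`). [folklore] -/
private theorem abs_apply_le_norm (A : Λ → ℝ) (b : Λ) : |A b| ≤ ‖A‖ := by
  simpa [Real.norm_eq_abs] using norm_le_pi_norm A b

/-- Print's form of the cubic letter, `‖𝒲 A‖ ≤ c₃·Σ_{b∈S_Y}|A_b|³` on the box ([I] (2.10): the Wilson remainder of the domain
`Y` is a sum over its plaquettes, cubic at the origin), implies the Y-localised letter (ℓ1) `‖𝒲 A‖ ≤ c₃·‖A‖·Σ_{b∈S_Y} A_b²`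
(lens Sketch17 `loc_of_sumCubes`). [cite: Balaban1987RG1, (2.9)–(2.13) pp.266–268] -/
theorem loc_of_sumCubes {𝒲 : (Λ → ℝ) → ℂ} (SY : Finset Λ) {ρ c₃ : ℝ} (hc₃ : 0 ≤ c₃)
    (h : ∀ A, ‖A‖ ≤ ρ → ‖𝒲 A‖ ≤ c₃ * ∑ b ∈ SY, |A b| ^ 3) :
    ∀ A, ‖A‖ ≤ ρ → ‖𝒲 A‖ ≤ c₃ * ‖A‖ * ∑ b ∈ SY, A b ^ 2 := by
  intro A hA
  have hb : ∀ b ∈ SY, |A b| ^ 3 ≤ ‖A‖ * A b ^ 2 := fun b _ => by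
    calc |A b| ^ 3 = |A b| * A b ^ 2 := by rw [pow_succ', sq_abs]
      _ ≤ ‖A‖ * A b ^ 2 := mul_le_mul_of_nonneg_right (abs_apply_le_norm A b) (sq_nonneg _)
  calc ‖𝒲 A‖ ≤ c₃ * ∑ b ∈ SY, |A b| ^ 3 := h A hA
    _ ≤ c₃ * ∑ b ∈ SY, ‖A‖ * A b ^ 2 := mul_le_mul_of_nonneg_left (Finset.sum_le_sum hb) hc₃
    _ = c₃ * ‖A‖ * ∑ b ∈ SY, A b ^ 2 := by rw [← Finset.mul_sum]; ring

/-- (ℓ1) implies the GLOBAL cubic letter (L1) of §1∕§2 with constant `c₃·|S_Y|` (lens Sketch17 `cubic_global_of_loc`) — so the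
other weighted letters (`h1eU ∕ h2eU ∕ w`) keep consuming (L1). [cite: Balaban1987RG1, (2.9)–(2.13) pp.266–268] -/
theorem cubic_global_of_loc {𝒲 : (Λ → ℝ) → ℂ} (SY : Finset Λ) {ρ c₃ : ℝ} (hc₃ : 0 ≤ c₃)
    (h : ∀ A, ‖A‖ ≤ ρ → ‖𝒲 A‖ ≤ c₃ * ‖A‖ * ∑ b ∈ SY, A b ^ 2) :
    ∀ A, ‖A‖ ≤ ρ → ‖𝒲 A‖ ≤ (c₃ * SY.card) * ‖A‖ ^ 3 := by
  intro A hA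
  have hb : ∀ b ∈ SY, A b ^ 2 ≤ ‖A‖ ^ 2 := fun b _ => by
    rw [← sq_abs]
    exact pow_le_pow_left₀ (abs_nonneg _) (abs_apply_le_norm A b) 2
  calc ‖𝒲 A‖ ≤ c₃ * ‖A‖ * ∑ b ∈ SY, A b ^ 2 := h A hA
    _ ≤ c₃ * ‖A‖ * (SY.card * ‖A‖ ^ 2) := by
        refine mul_le_mul_of_nonneg_left ?_ (mul_nonneg hc₃ (norm_nonneg _))
        calc ∑ b ∈ SY, A b ^ 2 ≤ ∑ b ∈ SY, ‖A‖ ^ 2 := Finset.sum_le_sum hb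
          _ = SY.card * ‖A‖ ^ 2 := by rw [Finset.sum_const, nsmul_eq_mul]
    _ = (c₃ * SY.card) * ‖A‖ ^ 3 := by ring

/-- **The per-Y (2.20) contribution with the LOCAL quadratic form** (lens Sketch17 `h220_clip_pointwise_loc`): under (ℓ1), for
every `s > 0` and EVERY `B`, `‖s⁻²𝒲(clip ρ(sB))‖ ≤ c₃ρ·Σ_{b∈S_Y} B_b²` (the coordinates outside `S_Y`, in particular the
`P`-coordinates, are free). [cite: Balaban1988RG2Cluster, (2.20) p.16, (1.20) p.6; Balaban1987RG1, (2.9)–(2.10) pp.266–267] -/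
theorem h220_clip_pointwise_loc {𝒲 : (Λ → ℝ) → ℂ} (SY : Finset Λ) {ρ c₃ s : ℝ} (hs : 0 < s) (hρ : 0 ≤ ρ)
    (hc₃ : 0 ≤ c₃) (h : ∀ A, ‖A‖ ≤ ρ → ‖𝒲 A‖ ≤ c₃ * ‖A‖ * ∑ b ∈ SY, A b ^ 2) (B : Λ → ℝ) :
    ‖((s : ℂ) ^ 2)⁻¹ * 𝒲 (clip ρ (s • B))‖ ≤ c₃ * ρ * ∑ b ∈ SY, B b ^ 2 := by
  have hc : ‖clip ρ (s • B)‖ ≤ ρ := norm_clip_le hρ _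
  have hcoord : ∀ b, (clip ρ (s • B) b) ^ 2 ≤ (s * B b) ^ 2 := fun b => by
    have h' : |clip ρ (s • B) b| ≤ |s * B b| := by simpa using abs_clip_le_abs hρ (s • B) b
    exact sq_le_sq.mpr (by simpa only [abs_abs] using h')
  have hW : ‖𝒲 (clip ρ (s • B))‖ ≤ c₃ * ρ * (s ^ 2 * ∑ b ∈ SY, B b ^ 2) := by
    calc ‖𝒲 (clip ρ (s • B))‖ ≤ c₃ * ‖clip ρ (s • B)‖ * ∑ b ∈ SY, (clip ρ (s • B) b) ^ 2 := h _ hc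
      _ ≤ c₃ * ρ * ∑ b ∈ SY, (s * B b) ^ 2 :=
          mul_le_mul (mul_le_mul_of_nonneg_left hc hc₃) (Finset.sum_le_sum fun b _ => hcoord b)
            (Finset.sum_nonneg fun b _ => sq_nonneg _) (mul_nonneg hc₃ hρ)
      _ = c₃ * ρ * (s ^ 2 * ∑ b ∈ SY, B b ^ 2) := by
          congr 1
          rw [Finset.mul_sum]
          exact Finset.sum_congr rfl fun b _ => by ring
  have hs2 : (s ^ 2)⁻¹ * s ^ 2 = 1 := inv_mul_cancel₀ (by positivity)
  rw [norm_mul, norm_inv, norm_pow, Complex.norm_real, Real.norm_eq_abs, abs_of_pos hs]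
  calc (s ^ 2)⁻¹ * ‖𝒲 (clip ρ (s • B))‖ ≤ (s ^ 2)⁻¹ * (c₃ * ρ * (s ^ 2 * ∑ b ∈ SY, B b ^ 2)) :=
        mul_le_mul_of_nonneg_left hW (by positivity)
    _ = ((s ^ 2)⁻¹ * s ^ 2) * (c₃ * ρ * ∑ b ∈ SY, B b ^ 2) := by ring
    _ = c₃ * ρ * ∑ b ∈ SY, B b ^ 2 := by rw [hs2, one_mul]

/-- **THE (2.20) LETTER `h220U` OF THE CLIPPED TWIN WITH THE PER-BOND RATE** (lens Card T29 ∕ Sketch17 `h220U_clip_perBond`):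
with per-domain τ-radii `R(Y)`, per-domain constants, the Y-LOCALISED cubic letter (ℓ1) on the bond supports `S Y`, and the
PER-BOND multiplicity `∀ b, Σ_{Y∈𝐃, b∈S Y} R(Y)c₃(Y) ≤ m₃`: for every `s > 0` and EVERY `B`,
`Σ_Y |τ Y|·‖𝐕^π_s(Y,B)‖ ≤ ½(2ρ·m₃)·B·B + Σ_Y R(Y)(c₀(Y) + c₁(Y)ρ)` — the rate `a₂₀ = 2ρ·m₃` is VOLUME-FREE (print's «this yields a
constant O(1) … hence we can bound it by 1»); the shape of `B13Bound226CentredRem.h226_torus_windowDilated_centred_of_primitives_exp`'s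
`h220U`. [cite: Balaban1988RG2Cluster, (2.19)–(2.20) p.16, (1.42) p.11, (1.20) p.6, (2.14) p.15; Balaban1987RG1, (2.9)–(2.13) pp.266–268] -/
theorem h220U_clip_perBond [DecidableEq Λ] {𝒲 𝒪 : D → (Λ → ℝ) → ℂ} (Dfam : Finset D) (Uτ : D → Set ℂ)
    (S : D → Finset Λ) {R c₀ c₁ c₃ : D → ℝ} {ρ s m₃ : ℝ} (hs : 0 < s) (hρ : 0 ≤ ρ)
    (hR : ∀ Y ∈ Dfam, 0 ≤ R Y) (hc₃ : ∀ Y ∈ Dfam, 0 ≤ c₃ Y) (hc₁ : ∀ Y ∈ Dfam, 0 ≤ c₁ Y)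
    (hUτ : ∀ Y ∈ Dfam, ∀ z ∈ Uτ Y, ‖z‖ ≤ R Y) (h0 : ∀ Y ∈ Dfam, ‖𝒪 Y 0‖ ≤ c₀ Y)
    (h1loc : ∀ Y ∈ Dfam, ∀ A, ‖A‖ ≤ ρ → ‖𝒲 Y A‖ ≤ c₃ Y * ‖A‖ * ∑ b ∈ S Y, A b ^ 2)
    (h4 : ∀ Y ∈ Dfam, ∀ A, ‖A‖ ≤ ρ → ‖𝒪 Y A - 𝒪 Y 0‖ ≤ c₁ Y * ‖A‖)
    (hm₃ : ∀ b, ∑ Y ∈ Dfam with b ∈ S Y, R Y * c₃ Y ≤ m₃) :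
    ∀ τ : D → ℂ, (∀ Y, τ Y ∈ Uτ Y) → ∀ B : Λ → ℝ,
      ∑ Y ∈ Dfam, ‖τ Y‖ * ‖Vclip ρ s 𝒲 𝒪 Y B‖
        ≤ (2 * ρ * m₃) / 2 * (B ⬝ᵥ B) + ∑ Y ∈ Dfam, R Y * (c₀ Y + c₁ Y * ρ) := by
  intro τ hτ B
  have hE : ∀ Y ∈ Dfam, ‖τ Y‖ * ‖Vclip ρ s 𝒲 𝒪 Y B‖
      ≤ (R Y * c₃ Y) * (ρ * ∑ b ∈ S Y, B b ^ 2) + R Y * (c₀ Y + c₁ Y * ρ) := by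
    intro Y hY
    have hO : ‖𝒪 Y (clip ρ (s • B))‖ ≤ c₀ Y + c₁ Y * ρ := by
      have hd : ‖𝒪 Y (clip ρ (s • B)) - 𝒪 Y 0‖ ≤ c₁ Y * ρ :=
        (h4 Y hY _ (norm_clip_le hρ _)).trans (mul_le_mul_of_nonneg_left (norm_clip_le hρ _) (hc₁ Y hY))
      calc ‖𝒪 Y (clip ρ (s • B))‖ = ‖𝒪 Y 0 + (𝒪 Y (clip ρ (s • B)) - 𝒪 Y 0)‖ := by rw [add_sub_cancel]
        _ ≤ ‖𝒪 Y 0‖ + ‖𝒪 Y (clip ρ (s • B)) - 𝒪 Y 0‖ := norm_add_le _ _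
        _ ≤ c₀ Y + c₁ Y * ρ := add_le_add (h0 Y hY) hd
    have hV : ‖Vclip ρ s 𝒲 𝒪 Y B‖ ≤ c₃ Y * ρ * ∑ b ∈ S Y, B b ^ 2 + (c₀ Y + c₁ Y * ρ) :=
      calc ‖Vclip ρ s 𝒲 𝒪 Y B‖ ≤ ‖((s : ℂ) ^ 2)⁻¹ * 𝒲 Y (clip ρ (s • B))‖ + ‖𝒪 Y (clip ρ (s • B))‖ := norm_add_le _ _
        _ ≤ c₃ Y * ρ * ∑ b ∈ S Y, B b ^ 2 + (c₀ Y + c₁ Y * ρ) :=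
            add_le_add (h220_clip_pointwise_loc (S Y) hs hρ (hc₃ Y hY) (h1loc Y hY) B) hO
    calc ‖τ Y‖ * ‖Vclip ρ s 𝒲 𝒪 Y B‖ ≤ R Y * (c₃ Y * ρ * ∑ b ∈ S Y, B b ^ 2 + (c₀ Y + c₁ Y * ρ)) :=
          mul_le_mul (hUτ Y hY _ (hτ Y)) hV (norm_nonneg _) (hR Y hY)
      _ = (R Y * c₃ Y) * (ρ * ∑ b ∈ S Y, B b ^ 2) + R Y * (c₀ Y + c₁ Y * ρ) := by ring
  calc ∑ Y ∈ Dfam, ‖τ Y‖ * ‖Vclip ρ s 𝒲 𝒪 Y B‖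
      ≤ ∑ Y ∈ Dfam, ((R Y * c₃ Y) * (ρ * ∑ b ∈ S Y, B b ^ 2) + R Y * (c₀ Y + c₁ Y * ρ)) := Finset.sum_le_sum hE
    _ = ρ * ∑ Y ∈ Dfam, (R Y * c₃ Y) * ∑ b ∈ S Y, B b ^ 2 + ∑ Y ∈ Dfam, R Y * (c₀ Y + c₁ Y * ρ) := by
        rw [Finset.sum_add_distrib, Finset.mul_sum]
        congr 1
        exact Finset.sum_congr rfl fun Y _ => by ring
    _ ≤ ρ * (m₃ * (B ⬝ᵥ B)) + ∑ Y ∈ Dfam, R Y * (c₀ Y + c₁ Y * ρ) :=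
        add_le_add (mul_le_mul_of_nonneg_left (sum_weight_localSq_le Dfam S hm₃ B) hρ) le_rfl
    _ = (2 * ρ * m₃) / 2 * (B ⬝ᵥ B) + ∑ Y ∈ Dfam, R Y * (c₀ Y + c₁ Y * ρ) := by ring

omit [Fintype Λ] in
/-- **Per-bond multiplicity from shells** (lens Sketch17 `perBond_of_shells`; the print mechanism «use the first exponential factor
in (2.19) to bound the sum»): if every domain has a shell index `ℓ Y ≤ nmax`, the rate weight is bounded by a shell profile
`R(Y)c₃(Y) ≤ g(ℓ Y)` with `g ≥ 0`, and the number of domains of shell `n` containing the bond `b` is `≤ N n`, then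
`Σ_{Y∋b} R(Y)c₃(Y) ≤ Σ_{n ≤ nmax} N n·g n`. [cite: Balaban1988RG2Cluster, (2.18)–(2.20) p.16, (1.42) p.11] -/
theorem perBond_of_shells [DecidableEq Λ] (Dfam : Finset D) (S : D → Finset Λ) (ℓ : D → ℕ) {R c₃ : D → ℝ}
    {g N : ℕ → ℝ} (nmax : ℕ) (hℓ : ∀ Y ∈ Dfam, ℓ Y ≤ nmax) (hg : ∀ Y ∈ Dfam, R Y * c₃ Y ≤ g (ℓ Y))
    (hg0 : ∀ n, 0 ≤ g n) (hN : ∀ b n, (({Y ∈ Dfam | b ∈ S Y ∧ ℓ Y = n} : Finset D).card : ℝ) ≤ N n) (b : Λ) :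
    ∑ Y ∈ Dfam with b ∈ S Y, R Y * c₃ Y ≤ ∑ n ∈ Finset.range (nmax + 1), N n * g n := by
  have hmaps : ∀ Y ∈ ({Y ∈ Dfam | b ∈ S Y} : Finset D), ℓ Y ∈ Finset.range (nmax + 1) := fun Y hY =>
    Finset.mem_range.mpr (Nat.lt_succ_of_le (hℓ Y (Finset.mem_filter.mp hY).1))
  calc ∑ Y ∈ Dfam with b ∈ S Y, R Y * c₃ Y ≤ ∑ Y ∈ Dfam with b ∈ S Y, g (ℓ Y) :=
        Finset.sum_le_sum fun Y hY => hg Y (Finset.mem_filter.mp hY).1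
    _ = ∑ n ∈ Finset.range (nmax + 1), ∑ Y ∈ ({Y ∈ Dfam | b ∈ S Y} : Finset D) with ℓ Y = n, g (ℓ Y) :=
        (Finset.sum_fiberwise_of_maps_to hmaps _).symm
    _ = ∑ n ∈ Finset.range (nmax + 1), ((({Y ∈ Dfam | b ∈ S Y ∧ ℓ Y = n} : Finset D).card : ℝ) * g n) := by
        refine Finset.sum_congr rfl fun n _ => ?_
        rw [Finset.filter_filter, Finset.sum_congr rfl fun Y hY => by rw [(Finset.mem_filter.mp hY).2.2],
          Finset.sum_const, nsmul_eq_mul]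
    _ ≤ ∑ n ∈ Finset.range (nmax + 1), N n * g n :=
        Finset.sum_le_sum fun n _ => mul_le_mul_of_nonneg_right (hN b n) (hg0 n)

/-- One shell (lens Sketch17 `shell_term_le`): `N n ≤ e^{c₀ n}` domains, weight `≤ C e^{−κ′ n}`, and `κ′ ≥ c₀ + log 2` give the
geometric term `C·(1/2)^n` (tree-length counting × the (1.42)∕(2.18) decay). [cite: Balaban1988RG2Cluster, (2.18)–(2.19) p.16, (1.42) p.11] -/
theorem shell_term_le {c₀ κ' C Nn gn : ℝ} (n : ℕ) (hC : 0 ≤ C) (hgn : 0 ≤ gn)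
    (hN : Nn ≤ Real.exp (c₀ * n)) (hg : gn ≤ C * Real.exp (-(κ' * n))) (hκ : c₀ + Real.log 2 ≤ κ') :
    Nn * gn ≤ C * (1 / 2) ^ n := by
  have hn : (0 : ℝ) ≤ n := Nat.cast_nonneg n
  calc Nn * gn ≤ Real.exp (c₀ * n) * (C * Real.exp (-(κ' * n))) := mul_le_mul hN hg hgn (Real.exp_pos _).le
    _ = C * Real.exp (-((κ' - c₀) * n)) := by
        rw [mul_left_comm, ← Real.exp_add]
        congr 1
        ring_nf
    _ ≤ C * Real.exp (-(Real.log 2 * n)) := by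
        refine mul_le_mul_of_nonneg_left (Real.exp_le_exp.mpr ?_) hC
        nlinarith
    _ = C * (1 / 2) ^ n := by
        rw [show -(Real.log 2 * (n : ℝ)) = (n : ℝ) * (-Real.log 2) by ring, Real.exp_nat_mul, Real.exp_neg,
          Real.exp_log (by norm_num : (0 : ℝ) < 2), one_div]

/-- Summing the shells (lens Sketch17 `shells_geometric`): `Σ_{n<K} N n·g n ≤ 2C` — the volume-free per-bond multiplicity
`m₃ := 2C`. [cite: Balaban1988RG2Cluster, (2.19)–(2.20) p.16] (elementary) -/
theorem shells_geometric {N g : ℕ → ℝ} {C : ℝ} (hC : 0 ≤ C) (h : ∀ n : ℕ, N n * g n ≤ C * (1 / 2) ^ n)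
    (K : ℕ) : ∑ n ∈ Finset.range K, N n * g n ≤ 2 * C := by
  calc ∑ n ∈ Finset.range K, N n * g n ≤ ∑ n ∈ Finset.range K, C * (1 / 2 : ℝ) ^ n :=
        Finset.sum_le_sum fun n _ => h n
    _ = C * ∑ n ∈ Finset.range K, (1 / 2 : ℝ) ^ n := by rw [Finset.mul_sum]
    _ ≤ C * 2 := mul_le_mul_of_nonneg_left (sum_geometric_two_le K) hC
    _ = 2 * C := by ring

omit [Fintype Λ] in
/-- **The chain closed** (lens Sketch17 `hm₃_of_shells`): shells + decay ⇒ the per-bond multiplicity hypothesis `hm₃` of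
`h220U_clip_perBond` with `m₃ = 2C` — VOLUME-FREE (this is where `d_k(Y)` enters, never `|Z|`).
[cite: Balaban1988RG2Cluster, (2.18)–(2.20) p.16, (1.42) p.11] -/
theorem hm₃_of_shells [DecidableEq Λ] (Dfam : Finset D) (S : D → Finset Λ) (ℓ : D → ℕ) {R c₃ : D → ℝ}
    {g N : ℕ → ℝ} {C : ℝ} (nmax : ℕ) (hC : 0 ≤ C) (hℓ : ∀ Y ∈ Dfam, ℓ Y ≤ nmax)
    (hg : ∀ Y ∈ Dfam, R Y * c₃ Y ≤ g (ℓ Y)) (hg0 : ∀ n, 0 ≤ g n)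
    (hN : ∀ b n, (({Y ∈ Dfam | b ∈ S Y ∧ ℓ Y = n} : Finset D).card : ℝ) ≤ N n)
    (hterm : ∀ n : ℕ, N n * g n ≤ C * (1 / 2) ^ n) :
    ∀ b, ∑ Y ∈ Dfam with b ∈ S Y, R Y * c₃ Y ≤ 2 * C := fun b =>
  (perBond_of_shells Dfam S ℓ nmax hℓ hg hg0 hN b).trans (shells_geometric hC hterm _)

end PerBond

/-! ## §4. The centred letter for the unscaled-field law from LOCAL growth letters, PER-BOND rate (v1.1; volume-free) -/

section TorusPerBond

variable {d L N' : ℕ} [NeZero L] [NeZero N'] {M : ℕ}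
variable {ν : ℕ} {Nf : Fin ν → ℕ} [∀ i, NeZero (Nf i)]
variable {Λ : Type} [Fintype Λ] [DecidableEq Λ] {C₀ : Type} [Fintype C₀] [DecidableEq C₀]

open Classical in
/-- **THE CENTRED LETTER ALONG THE WINDOW-DILATED FAMILY FOR THE UNSCALED-FIELD LAW, FROM LOCAL GROWTH LETTERS, PER-BOND RATE**
(v1.1; the VOLUME-FREE edition of `h226_torus_windowDilated_centred_of_localGrowth`: the (2.20) rate is print's per-bond
resummation `a₂₀ = 2ρ·m₃`, `m₃ ≥ sup_b Σ_{Y∈𝐃, b∈S Y} R(Y)c₃(Y)` from the Y-LOCALISED cubic letter (ℓ1) on the bond supports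
`S Y` — [II] p.16 between (2.19) and (2.20): *"resummed over all Y∈𝐃_k containing, for example, the point b₋ … this yields a
constant O(1)"* — instead of the Y-sum `2ρΣ_Y R(Y)c₃(Y)`, which caps the cluster size (`ySum_rate_caps_card`); node N22's
(S-vertex-T′) per term, for the b = 1 member `𝐕_s(Y,B) = s⁻²𝒲(Y,sB) + 𝒪(Y,sB)` of [I] p. 267 at a real base point `s > 0`, centre
`𝐕₀ = 𝒪(·,0)`).  Data and letters AT THE REAL COUPLING as in
`B13Bound226CentredRem.h226_torus_windowDilated_centred_of_primitives_exp` (kernels `A(σ)`, `Γ(σ)X = G(σ)·X`, boxes `χ, χᶜ ≥ 0`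
measurable and EVEN with (2.22), the reference `C ≻ 0`, `Γ₀`, the (L17a)∕(L16a) letters on the open σ-polydisc, `K_E`, `ρ_b < 1`
and the primed letters, the capstone's numeric conditions at `α = 2θ′ + γ₂ + a_c`, `hvol` with `w_c`), and for the last line ONLY:
the coupling-free functions `𝒲, 𝒲₃, 𝒪, D𝒪` (measurable in the field; `𝒲₃` cubic- and `D𝒪` linear-homogeneous under real
dilations), their LOCAL growth letters on the sup-ball `‖A‖ ≤ ρ` with constants DEPENDING ON THE DOMAIN — (L0) `‖𝒪(Y,0)‖ ≤ c₀(Y)`,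
(L1) `‖𝒲(Y,A)‖ ≤ c₃(Y)‖A‖³`, (L2) `‖𝒲 − 𝒲₃‖ ≤ c₄(Y)‖A‖⁴`, (L4) `‖𝒪(Y,A) − 𝒪(Y,0)‖ ≤ c₁(Y)‖A‖`,
(L5) `‖𝒪 − 𝒪(Y,0) − D𝒪‖ ≤ c₂(Y)‖A‖²` — and the global (L3) `‖𝒲₃‖ ≤ c₃′(Y)‖A‖³`, (L6) `‖D𝒪‖ ≤ c₁′(Y)‖A‖`, bounds `R(Y)` of the
per-domain τ-regions, the BOX-SUPPORT LAW `χ_{Y₀}(B) ≠ 0 → |sB(b)| ≤ ρ` on a coordinate set `S₀` and the `Y`-LOCALITY of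
`𝒲(Y,·)`, `𝒪(Y,·)` in `S₀` ([II] (2.2)–(2.3), [I] (2.9)); the bond supports `S Y`, the Y-LOCALISED cubic letter (ℓ1) `‖𝒲(Y,A)‖ ≤ c₃(Y)‖A‖Σ_{b∈S Y}A_b²` on the sup-ball and the PER-BOND multiplicity `∀ b, Σ_{Y∈𝐃, b∈S Y} R(Y)c₃(Y) ≤ m₃` (`m₃ ≥ 0`); ONE rate condition `2δ + 2ρ·m₃ ≤ a_c` (any `δ > 0`; volume-free) and the
centred constants' letter `e^{w₀}(K₂ + K₁²e^{w+w₀}) ≤ e^{w_c}` at the explicit weighted constants `w₀ = ΣR(Y)c₀(Y)`,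
`w = ΣR(Y)(c₀(Y) + c₁(Y)ρ)`, `K₁ = [ΣR(Y)(c₃(Y)(3/(eδ))³ + c₁(Y)/(eδ))]e^{δ/2}`,
`K₂ = [ΣR(Y)((c₄+(c₃+c₃′)/ρ)(Y)(4/(eδ))⁴ + (c₂+(c₁+c₁′)/ρ)(Y)(2/(eδ))²)]e^{δ/2}`.  Conclusion: for every `b` of the ball,
`‖term(b²A, bG, F214 χ χᶜ 𝐕_s) − term(b²A, bG, F214 χ χᶜ 𝐕₀)‖ ≤ s²·weight L M c Z a t·exp(a₅|Z|)`.  Proof: the cited engine on the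
CLIPPED twin `Vclip ρ s 𝒲 𝒪` — every last-line binder discharged by `B13ClippedFieldLetters`, §1 and §3 (`h220U_clip_perBond`)
— then `F214(Vclip) = F214(Vlaw)` (`F214_clip_eq`).
[cite: Balaban1988RG2Cluster, (2.14)–(2.15) p.15, (2.16)–(2.22) p.16, (2.23)–(2.26) p.17, (2.18)–(2.20) p.16, (2.2)–(2.3) p.12, (1.42) p.11, (1.20) p.6; Balaban1987RG1, (2.9)–(2.13) pp.266–268] -/
theorem h226_torus_windowDilated_centred_of_localGrowth_perBond (c : B13.Consts) (hκ₁ : 1 ≤ c.κ₁) (hα₆ : c.α₆ ≠ 0)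
    (Z : TDom d N') (t : Finset (TDom d (L * N')) × Finset (TBond d M (L * N')))
    (hpos : ∀ Y : TDom d (L * N'), 0 < invTau c ((tsys d (L * N')).dj Y))
    (hhalf : ∀ Y : TDom d (L * N'), invTau c ((tsys d (L * N')).dj Y) ≤ 1 / 2)
    {Uσ : Set ℂ} {Uτ : TDom d (L * N') → Set ℂ} (hUσ : IsOpen Uσ) (hUτ : ∀ Y, IsOpen (Uτ Y))
    (hUexp : closedBall (0 : ℂ) (Real.exp c.κ₁) ⊆ Uσ)
    (hUtau : ∀ Y : TDom d (L * N'), closedBall (0 : ℂ) ((invTau c ((tsys d (L * N')).dj Y))⁻¹) ⊆ Uτ Y)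
    {r : ℝ} (hr : 0 < r) (hr' : r ≤ Real.exp c.κ₁ - 1)
    (hsubτ : ∀ Y, ∀ s ∈ Set.uIcc (0 : ℝ) 1, closedBall (s : ℂ) r ⊆ Uτ Y)
    (lZ : List (TPt d N')) (hlZ : lZ.Nodup ∧ lZ.toFinset = Z.1 \ tclosure L N' (Z0 M t))
    (lD : List (TDom d (L * N'))) (hlD : lD.Nodup ∧ lD.toFinset = t.1)
    -- the (2.14)-data AT THE REAL COUPLING (b = 1)
    (A : (TPt d N' → ℂ) → Matrix Λ Λ ℂ) (Γ : (TPt d N' → ℂ) → (Λ ⊕ C₀ → ℝ) → (Λ → ℂ))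
    {χY₀ χcP : (Λ → ℝ) → ℝ} (hχ0 : ∀ B, 0 ≤ χY₀ B) (hχc0 : ∀ B, 0 ≤ χcP B)
    (hχe : ∀ B, χY₀ (-B) = χY₀ B) (hχce : ∀ B, χcP (-B) = χcP B) (Dfam : Finset (TDom d (L * N')))
    -- the last line: the coupling-free functions of the unscaled-field law, at the coupling `s`, clipping radius `ρ`
    (𝒲 𝒲₃ 𝒪 D𝒪 : TDom d (L * N') → (Λ → ℝ) → ℂ) {ρ s : ℝ} (hs : 0 < s) (hρ : 0 < ρ)
    (h𝒲m : ∀ Y, Measurable (𝒲 Y)) (h𝒪m : ∀ Y, Measurable (𝒪 Y)) (h𝒲₃m : ∀ Y, Measurable (𝒲₃ Y))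
    (hD𝒪m : ∀ Y, Measurable (D𝒪 Y))
    (h𝒲₃ : ∀ Y (r : ℝ) A, 𝒲₃ Y (r • A) = (r : ℂ) ^ 3 * 𝒲₃ Y A)
    (hD𝒪 : ∀ Y (r : ℝ) A, D𝒪 Y (r • A) = (r : ℂ) * D𝒪 Y A)
    {C : Matrix Λ Λ ℝ} (hC : C.PosDef) (Γ₀ : Matrix Λ (Λ ⊕ C₀) ℝ)
    (hAhol : ∀ i j, DifferentiableOn ℂ (fun σ => A σ i j) {σ | ∀ j, σ j ∈ Uσ})
    (hχm : Measurable χY₀) (hχcm : Measurable χcP)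
    (hAs : ∀ σ : TPt d N' → ℂ, (∀ j, σ j ∈ Uσ) → (A σ).IsSymm)
    (G : (TPt d N' → ℂ) → Matrix Λ (Λ ⊕ C₀) ℂ)
    (hGhol : ∀ i j, DifferentiableOn ℂ (fun σ => G σ i j) {σ | ∀ j, σ j ∈ Uσ})
    (hlin : ∀ σ : TPt d N' → ℂ, (∀ j, σ j ∈ Uσ) → ∀ X : Λ ⊕ C₀ → ℝ, Γ σ X = G σ *ᵥ fun j => (X j : ℂ))
    -- (2.22)
    {γ₂ rP ac wc δ : ℝ} (qP : (Λ → ℝ) → ℝ)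
    (h222 : ∀ B, χY₀ B * χcP B ≤ Real.exp (-(γ₂ / 2 * rP ^ 2 * (t.2.card : ℕ)) + γ₂ / 2 * qP B)) (hγ₂ : 0 ≤ γ₂)
    (hqP : ∀ B, qP B ≤ B ⬝ᵥ B)
    -- the per-domain τ-regions are bounded by R(Y); the LOCAL growth letters (L0)–(L6) on the sup-ball of radius ρ with
    -- constants depending on the domain; any rate δ > 0
    (hδ : 0 < δ) {R c₀ c₃ c₃' c₄ c₁ c₁' c₂ : TDom d (L * N') → ℝ} (hR : ∀ Y ∈ Dfam, 0 ≤ R Y)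
    (hc₃ : ∀ Y ∈ Dfam, 0 ≤ c₃ Y) (hc₃' : ∀ Y ∈ Dfam, 0 ≤ c₃' Y) (hc₄ : ∀ Y ∈ Dfam, 0 ≤ c₄ Y)
    (hc₁ : ∀ Y ∈ Dfam, 0 ≤ c₁ Y) (hc₁' : ∀ Y ∈ Dfam, 0 ≤ c₁' Y) (hc₂ : ∀ Y ∈ Dfam, 0 ≤ c₂ Y)
    (hUτR : ∀ Y ∈ Dfam, ∀ z ∈ Uτ Y, ‖z‖ ≤ R Y)
    (h0 : ∀ Y ∈ Dfam, ‖𝒪 Y 0‖ ≤ c₀ Y)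
    (h1 : ∀ Y ∈ Dfam, ∀ A, ‖A‖ ≤ ρ → ‖𝒲 Y A‖ ≤ c₃ Y * ‖A‖ ^ 3)
    -- the Y-LOCALISED cubic letter (ℓ1) on the bond supports `S Y` and the PER-BOND multiplicity of the rate weights
    (S : TDom d (L * N') → Finset Λ)
    (h1loc : ∀ Y ∈ Dfam, ∀ A, ‖A‖ ≤ ρ → ‖𝒲 Y A‖ ≤ c₃ Y * ‖A‖ * ∑ b ∈ S Y, A b ^ 2)
    {m₃ : ℝ} (hm₃0 : 0 ≤ m₃) (hm₃ : ∀ b, ∑ Y ∈ Dfam with b ∈ S Y, R Y * c₃ Y ≤ m₃)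
    (h2 : ∀ Y ∈ Dfam, ∀ A, ‖A‖ ≤ ρ → ‖𝒲 Y A - 𝒲₃ Y A‖ ≤ c₄ Y * ‖A‖ ^ 4)
    (h3 : ∀ Y ∈ Dfam, ∀ A, ‖𝒲₃ Y A‖ ≤ c₃' Y * ‖A‖ ^ 3)
    (h4 : ∀ Y ∈ Dfam, ∀ A, ‖A‖ ≤ ρ → ‖𝒪 Y A - 𝒪 Y 0‖ ≤ c₁ Y * ‖A‖)
    (h5 : ∀ Y ∈ Dfam, ∀ A, ‖A‖ ≤ ρ → ‖𝒪 Y A - 𝒪 Y 0 - D𝒪 Y A‖ ≤ c₂ Y * ‖A‖ ^ 2)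
    (h6 : ∀ Y ∈ Dfam, ∀ A, ‖D𝒪 Y A‖ ≤ c₁' Y * ‖A‖)
    -- the BOX-SUPPORT LAW at the coupling and the Y-LOCALITY of the potentials (F214 does not see the clipping)
    (S₀ : Set Λ) (hbox : ∀ B, χY₀ B ≠ 0 → ∀ b ∈ S₀, |(s • B) b| ≤ ρ)
    (hloc𝒲 : ∀ Y ∈ Dfam, ∀ A A' : Λ → ℝ, (∀ b ∈ S₀, A b = A' b) → 𝒲 Y A = 𝒲 Y A')
    (hloc𝒪 : ∀ Y ∈ Dfam, ∀ A A' : Λ → ℝ, (∀ b ∈ S₀, A b = A' b) → 𝒪 Y A = 𝒪 Y A')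
    -- ONE rate condition (PER-BOND, volume-free) and the centred constants' letter at the explicit weighted constants
    (hac : 2 * δ + 2 * ρ * m₃ ≤ ac)
    (hwc : Real.exp (∑ Y ∈ Dfam, R Y * c₀ Y)
        * ((∑ Y ∈ Dfam, R Y * ((c₄ Y + (c₃ Y + c₃' Y) / ρ) * (4 / (Real.exp 1 * δ)) ^ 4
              + (c₂ Y + (c₁ Y + c₁' Y) / ρ) * (2 / (Real.exp 1 * δ)) ^ 2)) * Real.exp (δ / 2)
           + ((∑ Y ∈ Dfam, R Y * (c₃ Y * (3 / (Real.exp 1 * δ)) ^ 3 + c₁ Y * (1 / (Real.exp 1 * δ))))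
                * Real.exp (δ / 2)) ^ 2
              * Real.exp ((∑ Y ∈ Dfam, R Y * (c₀ Y + c₁ Y * ρ)) + ∑ Y ∈ Dfam, R Y * c₀ Y))
        ≤ Real.exp wc)
    -- bonds located on the torus `UT Nf`
    (locΛ : Λ → UT Nf) (locN : Λ ⊕ C₀ → UT Nf) {m : ℕ}
    (hfibΛ : ∀ x : UT Nf, (Finset.univ.filter fun i => locΛ i = x).card ≤ m)
    (hfibN : ∀ x : UT Nf, (Finset.univ.filter fun j => locN j = x).card ≤ m)
    -- rates and the letters AT b = 1 (+ K_E)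
    {kap kap' kap'' θ θE θΓ θC KG KΓ KCs K₀ KE : ℝ} (hkap'' : 0 < kap'') (hk1 : kap'' < kap') (hk2 : kap' < kap)
    (hθE : 0 ≤ θE) (hθΓ : 0 ≤ θΓ) (hθC : 0 ≤ θC) (hKG : 0 ≤ KG) (hKΓ : 0 ≤ KΓ) (hKCs : 0 ≤ KCs) (hK₀ : 0 ≤ K₀)
    (hKE : 0 ≤ KE)
    (hG : ∀ σ : TPt d N' → ℂ, (∀ j, σ j ∈ Uσ) →
      ∀ b j, ‖G σ b j‖ ≤ KG * Real.exp (-(kap * tdist1 Nf (locΛ b) (locN j))))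
    (hΓ₀ : ∀ b j, ‖Γ₀ b j‖ ≤ KΓ * Real.exp (-(kap * tdist1 Nf (locΛ b) (locN j))))
    (hCs : ∀ σ : TPt d N' → ℂ, (∀ j, σ j ∈ Uσ) →
      ∀ b b', ‖(A σ)⁻¹ b b'‖ ≤ KCs * Real.exp (-(kap * tdist1 Nf (locΛ b) (locΛ b'))))
    (hC216 : ∀ b b', ‖C b b'‖ ≤ K₀ * Real.exp (-(kap * tdist1 Nf (locΛ b) (locΛ b'))))
    (hCE : ∀ b b', ‖(C⁻¹.map (algebraMap ℝ ℂ)) b b'‖ ≤ KE * Real.exp (-(kap * tdist1 Nf (locΛ b) (locΛ b'))))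
    (hdΓ : ∀ σ : TPt d N' → ℂ, (∀ j, σ j ∈ Uσ) →
      ∀ b j, ‖(G σ - Γ₀.map (algebraMap ℝ ℂ)) b j‖ ≤ θΓ * Real.exp (-(kap * tdist1 Nf (locΛ b) (locN j))))
    (hdC : ∀ σ : TPt d N' → ℂ, (∀ j, σ j ∈ Uσ) →
      ∀ b b', ‖((A σ)⁻¹ - C.map (algebraMap ℝ ℂ)) b b'‖
        ≤ θC * Real.exp (-(kap * tdist1 Nf (locΛ b) (locΛ b'))))
    (hdE : ∀ σ : TPt d N' → ℂ, (∀ j, σ j ∈ Uσ) →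
      ∀ b b', ‖(A σ - C⁻¹.map (algebraMap ℝ ℂ)) b b'‖ ≤ θE * Real.exp (-(kap * tdist1 Nf (locΛ b) (locΛ b'))))
    {ρb KG' KCs' θΓ' θC' θE' : ℝ} (hρb1 : ρb < 1)
    (hKG' : (1 + ρb) * KG ≤ KG') (hKCs' : ((1 - ρb) ^ 2)⁻¹ * KCs ≤ KCs')
    (hθΓ' : θΓ + ρb * KG ≤ θΓ') (hθC' : θC + ρb * (2 + ρb) * ((1 - ρb) ^ 2)⁻¹ * KCs ≤ θC')
    (hθE' : θE + ρb * (2 + ρb) * (θE + KE) ≤ θE')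
    -- the capstone's numeric conditions in the primed letters, at the master rate γ₂ + a_c, with w_c
    (hθEle : θE' ≤ θ) (hθΓle : θΓ' ≤ θ)
    (hθR1le : (m * (1 + 2 / (kap - kap')) ^ ν) * (m * (1 + 2 / (kap' - kap'')) ^ ν)
      * (θΓ' * KCs' * KG' + KΓ * θC' * KG' + KΓ * K₀ * θΓ') ≤ θ)
    (hsmallKθ : K₀ * (m * (1 + 2 / kap) ^ ν) * (θ * (m * (1 + 2 / kap'') ^ ν)) < 1)
    {cE g : ℝ} (hc0 : 0 ≤ cE) (hc : ∀ k, hC.1.eigenvalues k ≤ cE)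
    (hαc : (2 * (θ * (m * (1 + 2 / kap'') ^ ν)) + (γ₂ + ac)) * cE ≤ 1 / 2) (hg : 0 ≤ g)
    (hΓq : ∀ X : Λ ⊕ C₀ → ℝ, (Γ₀ *ᵥ X) ⬝ᵥ (C *ᵥ (Γ₀ *ᵥ X)) ≤ g * (X ⬝ᵥ X))
    (hsmall : (2 * (θ * (m * (1 + 2 / kap'') ^ ν)) + (γ₂ + ac)) * (1 + 2 * cE * g) ≤ 1 / 2)
    {a a₅ : ℝ} (hPa : a ≤ γ₂ * rP ^ 2)
    (hvol : 2 * (K₀ * (m * (1 + 2 / kap) ^ ν) * (θ * (m * (1 + 2 / kap'') ^ ν))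
              * (1 + (1 - K₀ * (m * (1 + 2 / kap) ^ ν) * (θ * (m * (1 + 2 / kap'') ^ ν)))⁻¹) / 2)
          * (Fintype.card Λ : ℝ)
        + wc + (2 * (θ * (m * (1 + 2 / kap'') ^ ν)) + (γ₂ + ac)) * cE * (Fintype.card Λ : ℝ)
        + (2 * (θ * (m * (1 + 2 / kap'') ^ ν)) + (γ₂ + ac)) * (1 + 2 * cE * g) * (Fintype.card (Λ ⊕ C₀) : ℝ)
        ≤ a₅ * ((Z.1).card : ℝ))
    {b : ℂ} (hb : b ∈ ball (1 : ℂ) ρb) :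
    ‖term214 r lZ lD (core214 (fun σ => b ^ 2 • A σ) (fun σ X => b • Γ σ X)
          (F214 t.2.card χY₀ χcP Dfam (Vlaw s 𝒲 𝒪))) 0 0
        - term214 r lZ lD (core214 (fun σ => b ^ 2 • A σ) (fun σ X => b • Γ σ X)
          (F214 t.2.card χY₀ χcP Dfam (V₀ 𝒪))) 0 0‖ ≤
      s ^ 2 * (weight L M c Z a t * Real.exp (a₅ * ((Z.1).card : ℝ))) := by
  -- transport: the (2.14) last line does not see the clipping
  have hF : F214 t.2.card χY₀ χcP Dfam (Vlaw s 𝒲 𝒪) = F214 t.2.card χY₀ χcP Dfam (Vclip ρ s 𝒲 𝒪) := by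
    funext τ B
    exact (F214_clip_eq t.2.card χY₀ χcP Dfam S₀ hbox hloc𝒲 hloc𝒪 τ B).symm
  rw [hF]
  -- the per-bond rate: a₂₀ = 2ρ m₃, a₁ = a₂ = δ
  have ha₂₀ : 0 ≤ 2 * ρ * m₃ := by positivity
  have hac₀ : 2 * ρ * m₃ ≤ ac := by linarith only [hac, hδ.le]
  have hac₂ : δ ≤ ac := by linarith only [hac, hδ.le, ha₂₀]
  have hK₁ : 0 ≤ (∑ Y ∈ Dfam, R Y * (c₃ Y * (3 / (Real.exp 1 * δ)) ^ 3 + c₁ Y * (1 / (Real.exp 1 * δ))))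
      * Real.exp (δ / 2) :=
    mul_nonneg (Finset.sum_nonneg fun Y hY => mul_nonneg (hR Y hY)
      (add_nonneg (mul_nonneg (hc₃ Y hY) (by positivity)) (mul_nonneg (hc₁ Y hY) (by positivity)))) (Real.exp_pos _).le
  have hK₂ : 0 ≤ (∑ Y ∈ Dfam, R Y * ((c₄ Y + (c₃ Y + c₃' Y) / ρ) * (4 / (Real.exp 1 * δ)) ^ 4
      + (c₂ Y + (c₁ Y + c₁' Y) / ρ) * (2 / (Real.exp 1 * δ)) ^ 2)) * Real.exp (δ / 2) :=
    mul_nonneg (Finset.sum_nonneg fun Y hY => mul_nonneg (hR Y hY)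
      (add_nonneg
        (mul_nonneg (add_nonneg (hc₄ Y hY) (div_nonneg (add_nonneg (hc₃ Y hY) (hc₃' Y hY)) hρ.le)) (by positivity))
        (mul_nonneg (add_nonneg (hc₂ Y hY) (div_nonneg (add_nonneg (hc₁ Y hY) (hc₁' Y hY)) hρ.le)) (by positivity))))
      (Real.exp_pos _).le
  -- the engine on the clipped twin, every last-line binder discharged by `B13ClippedFieldLetters`, §1 and §3
  exact h226_torus_windowDilated_centred_of_primitives_exp c hκ₁ hα₆ Z t hpos hhalf hUσ hUτ hUexp hUtau hr hr' hsubτ lZ hlZ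
    lD hlD A Γ hχ0 hχc0 hχe hχce Dfam hC Γ₀ hAhol hχm hχcm (measurable_Vclip ρ s h𝒲m h𝒪m) (measurable_V₀ 𝒪)
    (measurable_V₁ s h𝒲₃m hD𝒪m) (V₀_even 𝒪) (V₁_odd s h𝒲₃ hD𝒪) hAs G hGhol hlin qP h222 hγ₂ hqP ha₂₀
    (h220U_clip_perBond Dfam Uτ S hs hρ.le hR hc₃ hc₁ hUτR h0 h1loc h4 hm₃) (hw₀U_clip_weighted Dfam Uτ hR hUτR h0)
    hs.le hK₁ hK₂ hδ.le
    (h1eU_clip_weighted Dfam Uτ hs hδ hρ.le hR hc₃ hc₁ hUτR h1 h4)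
    (h2eU_clip_weighted Dfam Uτ hs hδ hρ hR hc₃ hc₃' hc₄ hc₁ hc₁' hc₂ hUτR h1 h2 h3 h𝒲₃ h4 h5 h6 hD𝒪)
    hac₀ hac₂ hac hwc
    locΛ locN hfibΛ hfibN hkap'' hk1 hk2 hθE hθΓ hθC hKG hKΓ hKCs hK₀ hKE hG hΓ₀ hCs hC216 hCE hdΓ hdC hdE hρb1 hKG'
    hKCs' hθΓ' hθC' hθE' hθEle hθΓle hθR1le hsmallKθ hc0 hc hαc hg hΓq hsmall hPa hvol hb

end TorusPerBond

/-! ## §5. The `b`-member form (v1.2): the consumer's shape `b²·s⁻²𝒲(s·) + 𝒪(s·)` of the window-dilated family -/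

section Member

variable {d L N' : ℕ} [NeZero L] [NeZero N'] {M : ℕ}
variable {ν : ℕ} {Nf : Fin ν → ℕ} [∀ i, NeZero (Nf i)]
variable {Λ : Type} [Fintype Λ] [DecidableEq Λ] {C₀ : Type} [Fintype C₀] [DecidableEq C₀]
set_option maxHeartbeats 400000 in
open Classical in
/-- **THE CENTRED LETTER FOR THE `b`-MEMBER OF THE WINDOW-DILATED FAMILY OF THE UNSCALED-FIELD LAW, FROM LOCAL GROWTH LETTERS,
PER-BOND RATE** (v1.2; the consumer's shape — node N22's J-files display the member potentials
`𝐕_{s,b}(Y,B) = b²·s⁻²𝒲(Y,sB) + 𝒪(Y,sB)`, powers `(b², 1)` on (Wilson part, older terms), lens T20, at a real base point `s > 0`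
and a complex member `b` of the ball `|b − 1| < ρ_b < 1`).  Hypotheses = those of
`h226_torus_windowDilated_centred_of_localGrowth_perBond` ON THE UNDILATED `𝒲, 𝒲₃, 𝒪, D𝒪` (LOCAL letters (L0)–(L6) with
per-domain constants, the Y-localised (ℓ1), homogeneities, measurability, τ-radii `R(Y)`, box-support law, `Y`-locality, per-bond
multiplicity `m₃`), with the rate condition `2δ + 8ρ·m₃ ≤ a_c` and the centred constants' letter at the constants of the DILATED
Wilson part (`c₃, c₃′, c₄ ↦ 4c₃, 4c₃′, 4c₄`, as `‖b‖² < 4`).  Conclusion: for every `b` of the ball,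
`‖term(b²A, bG, F214 χ χᶜ 𝐕_{s,b}) − term(b²A, bG, F214 χ χᶜ 𝒪(·,0))‖ ≤ s²·weight L M c Z a t·exp(a₅|Z|)` with the last lines spelled
as the lambdas `fun Y B => b ^ 2 * (((s:ℂ)^2)⁻¹ * 𝒲 Y (s • B)) + 𝒪 Y (s • B)` and `fun Y _ => 𝒪 Y 0`.  Proof: the per-bond theorem
at `(b²𝒲, b²𝒲₃, 𝒪, D𝒪)` — cubic letters ×‖b‖² ≤ 4, homogeneity ∕ locality ∕ measurability preserved — and `Vlaw s (b²𝒲) 𝒪 =` the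
member lambda (`ring`). [cite: Balaban1988RG2Cluster, (2.14)–(2.15) p.15, (2.16)–(2.22) p.16, (2.23)–(2.26) p.17, (2.2)–(2.3) p.12, (1.42) p.11, (1.20) p.6; Balaban1987RG1, (2.9)–(2.13) pp.266–268] -/
theorem h226_torus_windowDilated_centred_of_localGrowth_perBond_member (c : B13.Consts) (hκ₁ : 1 ≤ c.κ₁) (hα₆ : c.α₆ ≠ 0)
    (Z : TDom d N') (t : Finset (TDom d (L * N')) × Finset (TBond d M (L * N')))
    (hpos : ∀ Y : TDom d (L * N'), 0 < invTau c ((tsys d (L * N')).dj Y))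
    (hhalf : ∀ Y : TDom d (L * N'), invTau c ((tsys d (L * N')).dj Y) ≤ 1 / 2)
    {Uσ : Set ℂ} {Uτ : TDom d (L * N') → Set ℂ} (hUσ : IsOpen Uσ) (hUτ : ∀ Y, IsOpen (Uτ Y))
    (hUexp : closedBall (0 : ℂ) (Real.exp c.κ₁) ⊆ Uσ)
    (hUtau : ∀ Y : TDom d (L * N'), closedBall (0 : ℂ) ((invTau c ((tsys d (L * N')).dj Y))⁻¹) ⊆ Uτ Y)
    {r : ℝ} (hr : 0 < r) (hr' : r ≤ Real.exp c.κ₁ - 1)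
    (hsubτ : ∀ Y, ∀ s ∈ Set.uIcc (0 : ℝ) 1, closedBall (s : ℂ) r ⊆ Uτ Y)
    (lZ : List (TPt d N')) (hlZ : lZ.Nodup ∧ lZ.toFinset = Z.1 \ tclosure L N' (Z0 M t))
    (lD : List (TDom d (L * N'))) (hlD : lD.Nodup ∧ lD.toFinset = t.1)
    -- the (2.14)-data AT THE REAL COUPLING (b = 1)
    (A : (TPt d N' → ℂ) → Matrix Λ Λ ℂ) (Γ : (TPt d N' → ℂ) → (Λ ⊕ C₀ → ℝ) → (Λ → ℂ))
    {χY₀ χcP : (Λ → ℝ) → ℝ} (hχ0 : ∀ B, 0 ≤ χY₀ B) (hχc0 : ∀ B, 0 ≤ χcP B)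
    (hχe : ∀ B, χY₀ (-B) = χY₀ B) (hχce : ∀ B, χcP (-B) = χcP B) (Dfam : Finset (TDom d (L * N')))
    -- the last line: the coupling-free functions of the unscaled-field law, at the coupling `s`, clipping radius `ρ`
    (𝒲 𝒲₃ 𝒪 D𝒪 : TDom d (L * N') → (Λ → ℝ) → ℂ) {ρ s : ℝ} (hs : 0 < s) (hρ : 0 < ρ)
    (h𝒲m : ∀ Y, Measurable (𝒲 Y)) (h𝒪m : ∀ Y, Measurable (𝒪 Y)) (h𝒲₃m : ∀ Y, Measurable (𝒲₃ Y))
    (hD𝒪m : ∀ Y, Measurable (D𝒪 Y))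
    (h𝒲₃ : ∀ Y (r : ℝ) A, 𝒲₃ Y (r • A) = (r : ℂ) ^ 3 * 𝒲₃ Y A)
    (hD𝒪 : ∀ Y (r : ℝ) A, D𝒪 Y (r • A) = (r : ℂ) * D𝒪 Y A)
    {C : Matrix Λ Λ ℝ} (hC : C.PosDef) (Γ₀ : Matrix Λ (Λ ⊕ C₀) ℝ)
    (hAhol : ∀ i j, DifferentiableOn ℂ (fun σ => A σ i j) {σ | ∀ j, σ j ∈ Uσ})
    (hχm : Measurable χY₀) (hχcm : Measurable χcP)
    (hAs : ∀ σ : TPt d N' → ℂ, (∀ j, σ j ∈ Uσ) → (A σ).IsSymm)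
    (G : (TPt d N' → ℂ) → Matrix Λ (Λ ⊕ C₀) ℂ)
    (hGhol : ∀ i j, DifferentiableOn ℂ (fun σ => G σ i j) {σ | ∀ j, σ j ∈ Uσ})
    (hlin : ∀ σ : TPt d N' → ℂ, (∀ j, σ j ∈ Uσ) → ∀ X : Λ ⊕ C₀ → ℝ, Γ σ X = G σ *ᵥ fun j => (X j : ℂ))
    -- (2.22)
    {γ₂ rP ac wc δ : ℝ} (qP : (Λ → ℝ) → ℝ)
    (h222 : ∀ B, χY₀ B * χcP B ≤ Real.exp (-(γ₂ / 2 * rP ^ 2 * (t.2.card : ℕ)) + γ₂ / 2 * qP B)) (hγ₂ : 0 ≤ γ₂)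
    (hqP : ∀ B, qP B ≤ B ⬝ᵥ B)
    -- the per-domain τ-regions are bounded by R(Y); the LOCAL growth letters (L0)–(L6) on the sup-ball of radius ρ with
    -- constants depending on the domain; any rate δ > 0
    (hδ : 0 < δ) {R c₀ c₃ c₃' c₄ c₁ c₁' c₂ : TDom d (L * N') → ℝ} (hR : ∀ Y ∈ Dfam, 0 ≤ R Y)
    (hc₃ : ∀ Y ∈ Dfam, 0 ≤ c₃ Y) (hc₃' : ∀ Y ∈ Dfam, 0 ≤ c₃' Y) (hc₄ : ∀ Y ∈ Dfam, 0 ≤ c₄ Y)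
    (hc₁ : ∀ Y ∈ Dfam, 0 ≤ c₁ Y) (hc₁' : ∀ Y ∈ Dfam, 0 ≤ c₁' Y) (hc₂ : ∀ Y ∈ Dfam, 0 ≤ c₂ Y)
    (hUτR : ∀ Y ∈ Dfam, ∀ z ∈ Uτ Y, ‖z‖ ≤ R Y)
    (h0 : ∀ Y ∈ Dfam, ‖𝒪 Y 0‖ ≤ c₀ Y)
    (h1 : ∀ Y ∈ Dfam, ∀ A, ‖A‖ ≤ ρ → ‖𝒲 Y A‖ ≤ c₃ Y * ‖A‖ ^ 3)
    -- the Y-LOCALISED cubic letter (ℓ1) on the bond supports `S Y` and the PER-BOND multiplicity of the rate weights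
    (S : TDom d (L * N') → Finset Λ)
    (h1loc : ∀ Y ∈ Dfam, ∀ A, ‖A‖ ≤ ρ → ‖𝒲 Y A‖ ≤ c₃ Y * ‖A‖ * ∑ b ∈ S Y, A b ^ 2)
    {m₃ : ℝ} (hm₃0 : 0 ≤ m₃) (hm₃ : ∀ bd, ∑ Y ∈ Dfam with bd ∈ S Y, R Y * c₃ Y ≤ m₃)
    (h2 : ∀ Y ∈ Dfam, ∀ A, ‖A‖ ≤ ρ → ‖𝒲 Y A - 𝒲₃ Y A‖ ≤ c₄ Y * ‖A‖ ^ 4)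
    (h3 : ∀ Y ∈ Dfam, ∀ A, ‖𝒲₃ Y A‖ ≤ c₃' Y * ‖A‖ ^ 3)
    (h4 : ∀ Y ∈ Dfam, ∀ A, ‖A‖ ≤ ρ → ‖𝒪 Y A - 𝒪 Y 0‖ ≤ c₁ Y * ‖A‖)
    (h5 : ∀ Y ∈ Dfam, ∀ A, ‖A‖ ≤ ρ → ‖𝒪 Y A - 𝒪 Y 0 - D𝒪 Y A‖ ≤ c₂ Y * ‖A‖ ^ 2)
    (h6 : ∀ Y ∈ Dfam, ∀ A, ‖D𝒪 Y A‖ ≤ c₁' Y * ‖A‖)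
    -- the BOX-SUPPORT LAW at the coupling and the Y-LOCALITY of the potentials (F214 does not see the clipping)
    (S₀ : Set Λ) (hbox : ∀ B, χY₀ B ≠ 0 → ∀ b ∈ S₀, |(s • B) b| ≤ ρ)
    (hloc𝒲 : ∀ Y ∈ Dfam, ∀ A A' : Λ → ℝ, (∀ b ∈ S₀, A b = A' b) → 𝒲 Y A = 𝒲 Y A')
    (hloc𝒪 : ∀ Y ∈ Dfam, ∀ A A' : Λ → ℝ, (∀ b ∈ S₀, A b = A' b) → 𝒪 Y A = 𝒪 Y A')
    -- ONE rate condition (PER-BOND, volume-free; ×4 for the dilated Wilson part) and the centred constants' letter at the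
    -- explicit weighted constants of the DILATED Wilson part (c₃, c₃′, c₄ ↦ 4c₃, 4c₃′, 4c₄)
    (hac : 2 * δ + 8 * ρ * m₃ ≤ ac)
    (hwc : Real.exp (∑ Y ∈ Dfam, R Y * c₀ Y)
        * ((∑ Y ∈ Dfam, R Y * ((4 * c₄ Y + (4 * c₃ Y + 4 * c₃' Y) / ρ) * (4 / (Real.exp 1 * δ)) ^ 4
              + (c₂ Y + (c₁ Y + c₁' Y) / ρ) * (2 / (Real.exp 1 * δ)) ^ 2)) * Real.exp (δ / 2)
           + ((∑ Y ∈ Dfam, R Y * (4 * c₃ Y * (3 / (Real.exp 1 * δ)) ^ 3 + c₁ Y * (1 / (Real.exp 1 * δ))))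
                * Real.exp (δ / 2)) ^ 2
              * Real.exp ((∑ Y ∈ Dfam, R Y * (c₀ Y + c₁ Y * ρ)) + ∑ Y ∈ Dfam, R Y * c₀ Y))
        ≤ Real.exp wc)
    -- bonds located on the torus `UT Nf`
    (locΛ : Λ → UT Nf) (locN : Λ ⊕ C₀ → UT Nf) {m : ℕ}
    (hfibΛ : ∀ x : UT Nf, (Finset.univ.filter fun i => locΛ i = x).card ≤ m)
    (hfibN : ∀ x : UT Nf, (Finset.univ.filter fun j => locN j = x).card ≤ m)
    -- rates and the letters AT b = 1 (+ K_E)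
    {kap kap' kap'' θ θE θΓ θC KG KΓ KCs K₀ KE : ℝ} (hkap'' : 0 < kap'') (hk1 : kap'' < kap') (hk2 : kap' < kap)
    (hθE : 0 ≤ θE) (hθΓ : 0 ≤ θΓ) (hθC : 0 ≤ θC) (hKG : 0 ≤ KG) (hKΓ : 0 ≤ KΓ) (hKCs : 0 ≤ KCs) (hK₀ : 0 ≤ K₀)
    (hKE : 0 ≤ KE)
    (hG : ∀ σ : TPt d N' → ℂ, (∀ j, σ j ∈ Uσ) →
      ∀ b j, ‖G σ b j‖ ≤ KG * Real.exp (-(kap * tdist1 Nf (locΛ b) (locN j))))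
    (hΓ₀ : ∀ b j, ‖Γ₀ b j‖ ≤ KΓ * Real.exp (-(kap * tdist1 Nf (locΛ b) (locN j))))
    (hCs : ∀ σ : TPt d N' → ℂ, (∀ j, σ j ∈ Uσ) →
      ∀ b b', ‖(A σ)⁻¹ b b'‖ ≤ KCs * Real.exp (-(kap * tdist1 Nf (locΛ b) (locΛ b'))))
    (hC216 : ∀ b b', ‖C b b'‖ ≤ K₀ * Real.exp (-(kap * tdist1 Nf (locΛ b) (locΛ b'))))
    (hCE : ∀ b b', ‖(C⁻¹.map (algebraMap ℝ ℂ)) b b'‖ ≤ KE * Real.exp (-(kap * tdist1 Nf (locΛ b) (locΛ b'))))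
    (hdΓ : ∀ σ : TPt d N' → ℂ, (∀ j, σ j ∈ Uσ) →
      ∀ b j, ‖(G σ - Γ₀.map (algebraMap ℝ ℂ)) b j‖ ≤ θΓ * Real.exp (-(kap * tdist1 Nf (locΛ b) (locN j))))
    (hdC : ∀ σ : TPt d N' → ℂ, (∀ j, σ j ∈ Uσ) →
      ∀ b b', ‖((A σ)⁻¹ - C.map (algebraMap ℝ ℂ)) b b'‖
        ≤ θC * Real.exp (-(kap * tdist1 Nf (locΛ b) (locΛ b'))))
    (hdE : ∀ σ : TPt d N' → ℂ, (∀ j, σ j ∈ Uσ) →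
      ∀ b b', ‖(A σ - C⁻¹.map (algebraMap ℝ ℂ)) b b'‖ ≤ θE * Real.exp (-(kap * tdist1 Nf (locΛ b) (locΛ b'))))
    {ρb KG' KCs' θΓ' θC' θE' : ℝ} (hρb1 : ρb < 1)
    (hKG' : (1 + ρb) * KG ≤ KG') (hKCs' : ((1 - ρb) ^ 2)⁻¹ * KCs ≤ KCs')
    (hθΓ' : θΓ + ρb * KG ≤ θΓ') (hθC' : θC + ρb * (2 + ρb) * ((1 - ρb) ^ 2)⁻¹ * KCs ≤ θC')
    (hθE' : θE + ρb * (2 + ρb) * (θE + KE) ≤ θE')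
    -- the capstone's numeric conditions in the primed letters, at the master rate γ₂ + a_c, with w_c
    (hθEle : θE' ≤ θ) (hθΓle : θΓ' ≤ θ)
    (hθR1le : (m * (1 + 2 / (kap - kap')) ^ ν) * (m * (1 + 2 / (kap' - kap'')) ^ ν)
      * (θΓ' * KCs' * KG' + KΓ * θC' * KG' + KΓ * K₀ * θΓ') ≤ θ)
    (hsmallKθ : K₀ * (m * (1 + 2 / kap) ^ ν) * (θ * (m * (1 + 2 / kap'') ^ ν)) < 1)
    {cE g : ℝ} (hc0 : 0 ≤ cE) (hc : ∀ k, hC.1.eigenvalues k ≤ cE)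
    (hαc : (2 * (θ * (m * (1 + 2 / kap'') ^ ν)) + (γ₂ + ac)) * cE ≤ 1 / 2) (hg : 0 ≤ g)
    (hΓq : ∀ X : Λ ⊕ C₀ → ℝ, (Γ₀ *ᵥ X) ⬝ᵥ (C *ᵥ (Γ₀ *ᵥ X)) ≤ g * (X ⬝ᵥ X))
    (hsmall : (2 * (θ * (m * (1 + 2 / kap'') ^ ν)) + (γ₂ + ac)) * (1 + 2 * cE * g) ≤ 1 / 2)
    {a a₅ : ℝ} (hPa : a ≤ γ₂ * rP ^ 2)
    (hvol : 2 * (K₀ * (m * (1 + 2 / kap) ^ ν) * (θ * (m * (1 + 2 / kap'') ^ ν))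
              * (1 + (1 - K₀ * (m * (1 + 2 / kap) ^ ν) * (θ * (m * (1 + 2 / kap'') ^ ν)))⁻¹) / 2)
          * (Fintype.card Λ : ℝ)
        + wc + (2 * (θ * (m * (1 + 2 / kap'') ^ ν)) + (γ₂ + ac)) * cE * (Fintype.card Λ : ℝ)
        + (2 * (θ * (m * (1 + 2 / kap'') ^ ν)) + (γ₂ + ac)) * (1 + 2 * cE * g) * (Fintype.card (Λ ⊕ C₀) : ℝ)
        ≤ a₅ * ((Z.1).card : ℝ))
    {b : ℂ} (hb : b ∈ ball (1 : ℂ) ρb) :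
    ‖term214 r lZ lD (core214 (fun σ => b ^ 2 • A σ) (fun σ X => b • Γ σ X)
          (F214 t.2.card χY₀ χcP Dfam
            (fun Y B => b ^ 2 * ((((s : ℝ) : ℂ) ^ 2)⁻¹ * 𝒲 Y (s • B)) + 𝒪 Y (s • B)))) 0 0
        - term214 r lZ lD (core214 (fun σ => b ^ 2 • A σ) (fun σ X => b • Γ σ X)
          (F214 t.2.card χY₀ χcP Dfam (fun Y _ => 𝒪 Y 0))) 0 0‖ ≤
      s ^ 2 * (weight L M c Z a t * Real.exp (a₅ * ((Z.1).card : ℝ))) := by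
  -- `‖b‖² ≤ 4` on the ball of radius `ρ_b < 1`
  have hb2 : ‖b‖ ^ 2 ≤ 4 := by
    have hb1 : ‖b‖ ≤ 2 := by
      have hd : dist b 1 < ρb := mem_ball.mp hb
      rw [dist_eq_norm] at hd
      have : ‖b‖ ≤ ‖b - 1‖ + ‖(1 : ℂ)‖ := by
        calc ‖b‖ = ‖(b - 1) + 1‖ := by rw [sub_add_cancel]
          _ ≤ ‖b - 1‖ + ‖(1 : ℂ)‖ := norm_add_le _ _
      rw [norm_one] at this
      linarith
    nlinarith [norm_nonneg b]
  have hnb : ‖b ^ 2‖ ≤ 4 := by rw [norm_pow]; exact hb2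
  -- the dilated Wilson part `b²𝒲`, `b²𝒲₃`: letters ×4, homogeneity ∕ locality ∕ measurability preserved
  have h𝒲bm : ∀ Y, Measurable (fun A => b ^ 2 * 𝒲 Y A) := fun Y => (h𝒲m Y).const_mul _
  have h𝒲₃bm : ∀ Y, Measurable (fun A => b ^ 2 * 𝒲₃ Y A) := fun Y => (h𝒲₃m Y).const_mul _
  have h𝒲₃b : ∀ Y (r : ℝ) A, b ^ 2 * 𝒲₃ Y (r • A) = (r : ℂ) ^ 3 * (b ^ 2 * 𝒲₃ Y A) := fun Y r A => by
    rw [h𝒲₃ Y r A]; ring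
  have hc₃b : ∀ Y ∈ Dfam, 0 ≤ 4 * c₃ Y := fun Y hY => by linarith [hc₃ Y hY]
  have hc₃'b : ∀ Y ∈ Dfam, 0 ≤ 4 * c₃' Y := fun Y hY => by linarith [hc₃' Y hY]
  have hc₄b : ∀ Y ∈ Dfam, 0 ≤ 4 * c₄ Y := fun Y hY => by linarith [hc₄ Y hY]
  have h1b : ∀ Y ∈ Dfam, ∀ A, ‖A‖ ≤ ρ → ‖b ^ 2 * 𝒲 Y A‖ ≤ 4 * c₃ Y * ‖A‖ ^ 3 := fun Y hY A hA => by
    rw [norm_mul]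
    calc ‖b ^ 2‖ * ‖𝒲 Y A‖ ≤ 4 * (c₃ Y * ‖A‖ ^ 3) :=
        mul_le_mul hnb (h1 Y hY A hA) (norm_nonneg _) (by norm_num)
      _ = 4 * c₃ Y * ‖A‖ ^ 3 := by ring
  have h1locb : ∀ Y ∈ Dfam, ∀ A, ‖A‖ ≤ ρ → ‖b ^ 2 * 𝒲 Y A‖ ≤ 4 * c₃ Y * ‖A‖ * ∑ b ∈ S Y, A b ^ 2 :=
    fun Y hY A hA => by
    rw [norm_mul]
    calc ‖b ^ 2‖ * ‖𝒲 Y A‖ ≤ 4 * (c₃ Y * ‖A‖ * ∑ b ∈ S Y, A b ^ 2) :=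
        mul_le_mul hnb (h1loc Y hY A hA) (norm_nonneg _) (by norm_num)
      _ = 4 * c₃ Y * ‖A‖ * ∑ b ∈ S Y, A b ^ 2 := by ring
  have h2b : ∀ Y ∈ Dfam, ∀ A, ‖A‖ ≤ ρ → ‖b ^ 2 * 𝒲 Y A - b ^ 2 * 𝒲₃ Y A‖ ≤ 4 * c₄ Y * ‖A‖ ^ 4 :=
    fun Y hY A hA => by
    rw [← mul_sub, norm_mul]
    calc ‖b ^ 2‖ * ‖𝒲 Y A - 𝒲₃ Y A‖ ≤ 4 * (c₄ Y * ‖A‖ ^ 4) :=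
        mul_le_mul hnb (h2 Y hY A hA) (norm_nonneg _) (by norm_num)
      _ = 4 * c₄ Y * ‖A‖ ^ 4 := by ring
  have h3b : ∀ Y ∈ Dfam, ∀ A, ‖b ^ 2 * 𝒲₃ Y A‖ ≤ 4 * c₃' Y * ‖A‖ ^ 3 := fun Y hY A => by
    rw [norm_mul]
    calc ‖b ^ 2‖ * ‖𝒲₃ Y A‖ ≤ 4 * (c₃' Y * ‖A‖ ^ 3) :=
        mul_le_mul hnb (h3 Y hY A) (norm_nonneg _) (by norm_num)
      _ = 4 * c₃' Y * ‖A‖ ^ 3 := by ring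
  have hloc𝒲b : ∀ Y ∈ Dfam, ∀ A A' : Λ → ℝ, (∀ b ∈ S₀, A b = A' b) → b ^ 2 * 𝒲 Y A = b ^ 2 * 𝒲 Y A' :=
    fun Y hY A A' h => by rw [hloc𝒲 Y hY A A' h]
  have hm₃b : ∀ bd, ∑ Y ∈ Dfam with bd ∈ S Y, R Y * (4 * c₃ Y) ≤ 4 * m₃ := fun bd => by
    calc ∑ Y ∈ Dfam with bd ∈ S Y, R Y * (4 * c₃ Y) = 4 * ∑ Y ∈ Dfam with bd ∈ S Y, R Y * c₃ Y := by
          rw [Finset.mul_sum]; exact Finset.sum_congr rfl fun Y _ => by ring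
      _ ≤ 4 * m₃ := mul_le_mul_of_nonneg_left (hm₃ bd) (by norm_num)
  have hm₃0b : 0 ≤ 4 * m₃ := by positivity
  have hacb : 2 * δ + 2 * ρ * (4 * m₃) ≤ ac := by linarith only [hac]
  -- the member's last line IS `Vlaw s (b²𝒲) 𝒪`
  have e : (fun Y B => b ^ 2 * ((((s : ℝ) : ℂ) ^ 2)⁻¹ * 𝒲 Y (s • B)) + 𝒪 Y (s • B))
      = Vlaw s (fun Y A => b ^ 2 * 𝒲 Y A) 𝒪 := by
    funext Y B; simp only [Vlaw]; ring
  rw [e]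
  exact h226_torus_windowDilated_centred_of_localGrowth_perBond c hκ₁ hα₆ Z t hpos hhalf hUσ hUτ hUexp hUtau hr hr' hsubτ
    lZ hlZ lD hlD A Γ hχ0 hχc0 hχe hχce Dfam (fun Y A => b ^ 2 * 𝒲 Y A) (fun Y A => b ^ 2 * 𝒲₃ Y A) 𝒪 D𝒪 hs hρ h𝒲bm h𝒪m
    h𝒲₃bm hD𝒪m h𝒲₃b hD𝒪 hC Γ₀ hAhol hχm hχcm hAs G hGhol hlin qP h222 hγ₂ hqP hδ (c₃ := fun Y => 4 * c₃ Y)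
    (c₃' := fun Y => 4 * c₃' Y) (c₄ := fun Y => 4 * c₄ Y) hR hc₃b hc₃'b hc₄b hc₁ hc₁' hc₂ hUτR h0 h1b S h1locb hm₃0b hm₃b
    h2b h3b h4 h5 h6 S₀ hbox hloc𝒲b hloc𝒪 hacb hwc locΛ locN hfibΛ hfibN hkap'' hk1 hk2 hθE hθΓ hθC hKG hKΓ hKCs hK₀ hKE
    hG hΓ₀ hCs hC216 hCE hdΓ hdC hdE hρb1 hKG' hKCs' hθΓ' hθC' hθE' hθEle hθΓle hθR1le hsmallKθ hc0 hc hαc hg hΓq hsmall hPa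
    hvol hb

end Member

end Literature.MathematicalPhysics.QuantumFieldTheory.Balaban1983to89.B13Bound226CentredUnscaled

end
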